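import Mathlib
import Summits.CriticalPhenomena.PercolationContinuityZ3.Theorems.PercNearOneGluingNoHeavyLowerTailStairKernels
import Summits.CriticalPhenomena.PercolationContinuityZ3.Theorems.PercNearOneGluingNoHeavyLowerTailHurwitzPairPivots
import HarnessLib

/-!
# CONJECTURE R at the vertex (1,0,0): one neutral copy and two classical copies

Support file for the Sahi / Conjecture-P programme of route `PercNearOneGluingNoHeavy`
(`--supports stmt-CriticalPhenomena-4575`, prover prim-l12-p5 gen 51; proof note
`prim-l12-p5/PROOF-VERTEX-100-g51.md`).  No definitions, no named facts, no sorries.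

CONJECTURE R (prim-l12-p5 gen 46–50) asserts that the operator Hurwitz matrix `interleave(W, SW - WS)`
of the band matrix `W` of a sub-neutral copy system is totally nonnegative; at the vertices `g ∈ {0,1}^T`
of the idle-ratio cube `W` factorises into first-order factors `Θ_b + r = bD + N̂ + r` (neutral, `g = 1`)
and `βD + 1` (classical, `g = 0`).  The all-neutral vertices (`…NeutralHurwitzRTN`), the all-classical
vertex (`…ClassicalVertexHurwitzTN`) and the whole `T = 2` square (`…TwoFactorHurwitzTN`,
`…NeutralClassicalHurwitzTN`) are in the tree; this file settles the `T = 3` vertex `(1,0,0)`: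
`W = (Θ_b + r)(β₂D + 1)(β₃D + 1)` (`neutralTwoClassical_hurwitz_tn`).  The proof is a seven-stage
adjacent-row elimination whose pivots are the polynomial families `D₂`, `P₃₆`, `P₁₀₅`, `P₆₉` (12, 36,
105, 69 terms); their positivity is certified by explicit discriminant / sum-of-squares identities
(`d2_pos`, `p36_pos`, `p105_pos`, `p69_pos`; `P₁₀₅ ≥ 0` was the piece left open by gen 50).
-/

namespace Summit.CriticalPhenomena.PercolationContinuityZ3.Theorems

namespace NeutralTwoClassical

open Finset Matrix

/-- A real quadratic `Ax² + Bx + C` with `A > 0` and `4AC - B² > 0` is positive. -/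
theorem quad_pos (A B C x : ℝ) (hA : 0 < A) (hD : 0 < 4 * A * C - B ^ 2) :
    0 < A * x ^ 2 + B * x + C := by
  have key : (A * x ^ 2 + B * x + C) * (4 * A) = (2 * A * x + B) ^ 2 + (4 * A * C - B ^ 2) := by ring
  have h : 0 < (A * x ^ 2 + B * x + C) * (4 * A) := by rw [key]; positivity
  exact pos_of_mul_pos_left h (by positivity)
/-- `D₂(k) > 0` for `k ≥ 0`: the stage-2/3 pivot family (a quadratic in `b` with negative discriminant). -/
theorem d2_pos (b β₂ β₃ r k : ℝ) (h₂ : 0 < β₂) (h₃ : 0 < β₃) (hr : 0 < r) (hk : 0 ≤ k) :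
    0 < 2 * b ^ 2 * β₂ ^ 2 - 2 * b ^ 2 * β₂ * β₃ + 2 * b ^ 2 * β₃ ^ 2 - 2 * (r - 1) * b * β₂ ^ 2 * β₃ - 2 * (r - 1) * b * β₂ * β₃ ^ 2 + (r + 2) * (3 * k + 2 * r + 1) * β₂ ^ 2 * β₃ ^ 2 := by
  have h4 : 0 < (2 * b ^ 2 * β₂ ^ 2 - 2 * b ^ 2 * β₂ * β₃ + 2 * b ^ 2 * β₃ ^ 2 - 2 * (r - 1) * b * β₂ ^ 2 * β₃ - 2 * (r - 1) * b * β₂ * β₃ ^ 2 + (r + 2) * (3 * k + 2 * r + 1) * β₂ ^ 2 * β₃ ^ 2) * (4 * (2 * ((β₂ - β₃) ^ 2 + β₂ * β₃))) := by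
    rw [show (2 * b ^ 2 * β₂ ^ 2 - 2 * b ^ 2 * β₂ * β₃ + 2 * b ^ 2 * β₃ ^ 2 - 2 * (r - 1) * b * β₂ ^ 2 * β₃ - 2 * (r - 1) * b * β₂ * β₃ ^ 2 + (r + 2) * (3 * k + 2 * r + 1) * β₂ ^ 2 * β₃ ^ 2) * (4 * (2 * ((β₂ - β₃) ^ 2 + β₂ * β₃))) = (2 * (2 * ((β₂ - β₃) ^ 2 + β₂ * β₃)) * b + (-(2 * (r - 1) * β₂ * β₃ * (β₂ + β₃)))) ^ 2 + 2 * β₂ ^ 2 * β₃ ^ 2 * (9 * r * (β₂ + β₃) ^ 2 + 3 * (β₂ - β₃) ^ 2 * (2 * r ^ 2 + 5 * r + 2) + 12 * k * (r + 2) * ((β₂ - β₃) ^ 2 + β₂ * β₃)) by ring]; positivity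
  exact pos_of_mul_pos_left h4 (by positivity)

/-- `P₃₆(k) > 0` for `k ≥ 1`, `b ≥ 0`: the stage-3/4 pivot family
(`P₃₆ = (β₃-β₂)²b³ + Q(b)`, `Q` a quadratic in `b` with negative discriminant). -/
theorem p36_pos (b β₂ β₃ r k : ℝ) (hb : 0 ≤ b) (h₂ : 0 < β₂) (h₃ : 0 < β₃) (hr : 0 < r) (hk : 1 ≤ k) :
    0 < b ^ 3 * β₂ ^ 2 - 2 * b ^ 3 * β₂ * β₃ + b ^ 3 * β₃ ^ 2 + (r + 1) * b ^ 2 * β₂ ^ 3 - b ^ 2 * β₂ ^ 2 * β₃ - b ^ 2 * β₂ * β₃ ^ 2 + (r + 1) * b ^ 2 * β₃ ^ 3 - 2 * (r + 1) * (k + r - 1) * b * β₂ ^ 3 * β₃ + 4 * (k + r - 1) * b * β₂ ^ 2 * β₃ ^ 2 - 2 * (r + 1) * (k + r - 1) * b * β₂ * β₃ ^ 3 + (k + r) * (r + 2) * (k + r - 1) * β₂ ^ 3 * β₃ ^ 2 + (k + r) * (r + 2) * (k + r - 1) * β₂ ^ 2 * β₃ ^ 3 := by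
  obtain ⟨ν, hν, rfl⟩ : ∃ ν, 0 ≤ ν ∧ k = ν + 1 := ⟨k - 1, by linarith, by ring⟩
  have hQ4 : 0 < ((β₂ + β₃) * (r * ((β₂ - β₃) ^ 2 + β₂ * β₃) + (β₂ - β₃) ^ 2) * b ^ 2 - 2 * β₂ * β₃ * (ν + r) * (r * ((β₂ - β₃) ^ 2 + β₂ * β₃) + (β₂ - β₃) ^ 2 + r * β₂ * β₃) * b + β₂ ^ 2 * β₃ ^ 2 * (β₂ + β₃) * (ν + 1 + r) * (r + 2) * (ν + r)) * (4 * (β₂ + β₃) * (r * ((β₂ - β₃) ^ 2 + β₂ * β₃) + (β₂ - β₃) ^ 2)) := by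
    rw [show ((β₂ + β₃) * (r * ((β₂ - β₃) ^ 2 + β₂ * β₃) + (β₂ - β₃) ^ 2) * b ^ 2 - 2 * β₂ * β₃ * (ν + r) * (r * ((β₂ - β₃) ^ 2 + β₂ * β₃) + (β₂ - β₃) ^ 2 + r * β₂ * β₃) * b + β₂ ^ 2 * β₃ ^ 2 * (β₂ + β₃) * (ν + 1 + r) * (r + 2) * (ν + r)) * (4 * (β₂ + β₃) * (r * ((β₂ - β₃) ^ 2 + β₂ * β₃) + (β₂ - β₃) ^ 2)) = (2 * (β₂ + β₃) * (r * ((β₂ - β₃) ^ 2 + β₂ * β₃) + (β₂ - β₃) ^ 2) * b - 2 * β₂ * β₃ * (ν + r) * (r * ((β₂ - β₃) ^ 2 + β₂ * β₃) + (β₂ - β₃) ^ 2 + r * β₂ * β₃)) ^ 2 + 4 * β₂ ^ 2 * β₃ ^ 2 * (ν + r) * ((β₂ + β₃) ^ 2 * (r * ((β₂ - β₃) ^ 2 + β₂ * β₃) + (β₂ - β₃) ^ 2) * (r + 2) + (ν + r) * ((r * ((β₂ - β₃) ^ 2 + β₂ * β₃) + (β₂ - β₃) ^ 2) * (β₂ ^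 2 + 6 * β₂ * β₃ + β₃ ^ 2) + r * β₂ * β₃ * (r + 1) * (β₂ - β₃) ^ 2)) by ring]
    positivity
  have hQ : 0 < (β₂ + β₃) * (r * ((β₂ - β₃) ^ 2 + β₂ * β₃) + (β₂ - β₃) ^ 2) * b ^ 2 - 2 * β₂ * β₃ * (ν + r) * (r * ((β₂ - β₃) ^ 2 + β₂ * β₃) + (β₂ - β₃) ^ 2 + r * β₂ * β₃) * b + β₂ ^ 2 * β₃ ^ 2 * (β₂ + β₃) * (ν + 1 + r) * (r + 2) * (ν + r) := pos_of_mul_pos_left hQ4 (by positivity)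
  nlinarith [hQ, (by positivity : 0 ≤ (β₃ - β₂) ^ 2 * b ^ 3)]

set_option maxHeartbeats 1000000 in -- one large `ring` certificate check (163-term identity)
set_option maxRecDepth 4000 in
/-- Discriminant certificate for `P₁₀₅`: with `β₃ = β₂ + δ`, `k = ν + 1`, the quantity
`4R₂R₀ - R₁²` is a polynomial with positive coefficients in `(δ, β₂, ν, r)`. -/
theorem p105_disc_pos (δ β₂ ν r : ℝ) (hδ : 0 ≤ δ) (h₂ : 0 < β₂) (hν : 0 ≤ ν) (hr : 0 < r) :
    0 < 4 * ((2 * ν * r + 2 * ν + 6 * r + 2 : ℝ) * δ ^ 4 + (8 * ν * r + 2 * ν + 16 * r + 4 : ℝ) * δ ^ 3 * β₂ + (10 * ν * r + 2 * ν + 20 * r + 4 : ℝ) * δ ^ 2 * β₂ ^ 2 + (4 * ν * r + 8 * r : ℝ) * δ * β₂ ^ 3 + (2 * ν * r + 4 * r : ℝ) * β₂ ^ 4) * ((2 * ν ^ 3 * r + 4 * ν ^ 3 + 4 * ν ^ 2 * r ^ 2 + 15 * ν ^ 2 * r + 10 * ν ^ 2 + 2 * ν * r ^ 3 + 15 * ν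 * r ^ 2 + 21 * ν * r + 6 * ν + 4 * r ^ 3 + 10 * r ^ 2 + 6 * r : ℝ) * δ ^ 4 * β₂ ^ 2 + (6 * ν ^ 3 * r + 12 * ν ^ 3 + 12 * ν ^ 2 * r ^ 2 + 44 * ν ^ 2 * r + 32 * ν ^ 2 + 6 * ν * r ^ 3 + 44 * ν * r ^ 2 + 66 * ν * r + 20 * ν + 12 * r ^ 3 + 32 * r ^ 2 + 20 * r : ℝ) * δ ^ 3 * β₂ ^ 3 + (8 * ν ^ 3 * r + 16 * ν ^ 3 + 16 * ν ^ 2 * r ^ 2 + 57 * ν ^ 2 * r + 46 * ν ^ 2 + 8 * ν * r ^ 3 + 57 * ν * r ^ 2 + 93 * ν * r + 30 * ν + 16 * r ^ 3 + 46 * r ^ 2 + 30 * r : ℝ) * δ ^ 2 * β₂ ^ 4 + (6 * ν ^ 3 * r + 12 * ν ^ 3 + 12 * ν ^ 2 * r ^ 2 + 42 * ν ^ 2 * r + 36 * ν ^ 2 + 6 * ν * r ^ 3 + 42 * ν * r ^ 2 + 72 * ν * r + 24 * ν + 12 * r ^ 3 + 36 * r ^ 2 + 24 * r : ℝ) * δ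 * β₂ ^ 5 + (2 * ν ^ 3 * r + 4 * ν ^ 3 + 4 * ν ^ 2 * r ^ 2 + 14 * ν ^ 2 * r + 12 * ν ^ 2 + 2 * ν * r ^ 3 + 14 * ν * r ^ 2 + 24 * ν * r + 8 * ν + 4 * r ^ 3 + 12 * r ^ 2 + 8 * r : ℝ) * β₂ ^ 6) - (-(4 * ν ^ 2 * r + 4 * ν ^ 2 + 4 * ν * r ^ 2 + 14 * ν * r + 6 * ν + 8 * r ^ 2 + 8 * r : ℝ) * δ ^ 4 * β₂ - (14 * ν ^ 2 * r + 12 * ν ^ 2 + 14 * ν * r ^ 2 + 46 * ν * r + 18 * ν + 28 * r ^ 2 + 24 * r : ℝ) * δ ^ 3 * β₂ ^ 2 - (16 * ν ^ 2 * r + 8 * ν ^ 2 + 16 * ν * r ^ 2 + 44 * ν * r + 12 * ν + 32 * r ^ 2 + 16 * r : ℝ) * δ ^ 2 * β₂ ^ 3 - (10 * ν ^ 2 * r + 10 * ν * r ^ 2 + 20 * ν * r + 20 * r ^ 2 : ℝ) * δ * β₂ ^ 4 - (4 * ν ^ 2 * r + 4 * ν * r ^ 2 + 8 * ν * r + 8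 * r ^ 2 : ℝ) * β₂ ^ 5) ^ 2 := by
  rw [show 4 * ((2 * ν * r + 2 * ν + 6 * r + 2 : ℝ) * δ ^ 4 + (8 * ν * r + 2 * ν + 16 * r + 4 : ℝ) * δ ^ 3 * β₂ + (10 * ν * r + 2 * ν + 20 * r + 4 : ℝ) * δ ^ 2 * β₂ ^ 2 + (4 * ν * r + 8 * r : ℝ) * δ * β₂ ^ 3 + (2 * ν * r + 4 * r : ℝ) * β₂ ^ 4) * ((2 * ν ^ 3 * r + 4 * ν ^ 3 + 4 * ν ^ 2 * r ^ 2 + 15 * ν ^ 2 * r + 10 * ν ^ 2 + 2 * ν * r ^ 3 + 15 * ν * r ^ 2 + 21 * ν * r + 6 * ν + 4 * r ^ 3 + 10 * r ^ 2 + 6 * r : ℝ) * δ ^ 4 * β₂ ^ 2 + (6 * ν ^ 3 * r + 12 * ν ^ 3 + 12 * ν ^ 2 * r ^ 2 + 44 * ν ^ 2 * r + 32 * ν ^ 2 + 6 * ν * r ^ 3 + 44 * ν * r ^ 2 + 66 * ν * r + 20 * ν + 12 * r ^ 3 + 32 * r ^ 2 + 20 * r : ℝ) * δ ^ 3 * β₂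 ^ 3 + (8 * ν ^ 3 * r + 16 * ν ^ 3 + 16 * ν ^ 2 * r ^ 2 + 57 * ν ^ 2 * r + 46 * ν ^ 2 + 8 * ν * r ^ 3 + 57 * ν * r ^ 2 + 93 * ν * r + 30 * ν + 16 * r ^ 3 + 46 * r ^ 2 + 30 * r : ℝ) * δ ^ 2 * β₂ ^ 4 + (6 * ν ^ 3 * r + 12 * ν ^ 3 + 12 * ν ^ 2 * r ^ 2 + 42 * ν ^ 2 * r + 36 * ν ^ 2 + 6 * ν * r ^ 3 + 42 * ν * r ^ 2 + 72 * ν * r + 24 * ν + 12 * r ^ 3 + 36 * r ^ 2 + 24 * r : ℝ) * δ * β₂ ^ 5 + (2 * ν ^ 3 * r + 4 * ν ^ 3 + 4 * ν ^ 2 * r ^ 2 + 14 * ν ^ 2 * r + 12 * ν ^ 2 + 2 * ν * r ^ 3 + 14 * ν * r ^ 2 + 24 * ν * r + 8 * ν + 4 * r ^ 3 + 12 * r ^ 2 + 8 * r : ℝ) * β₂ ^ 6) - (-(4 * ν ^ 2 * r + 4 * ν ^ 2 + 4 * ν * r ^ 2 + 14 * ν * r + 6 * ν + 8 * r ^ 2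 + 8 * r : ℝ) * δ ^ 4 * β₂ - (14 * ν ^ 2 * r + 12 * ν ^ 2 + 14 * ν * r ^ 2 + 46 * ν * r + 18 * ν + 28 * r ^ 2 + 24 * r : ℝ) * δ ^ 3 * β₂ ^ 2 - (16 * ν ^ 2 * r + 8 * ν ^ 2 + 16 * ν * r ^ 2 + 44 * ν * r + 12 * ν + 32 * r ^ 2 + 16 * r : ℝ) * δ ^ 2 * β₂ ^ 3 - (10 * ν ^ 2 * r + 10 * ν * r ^ 2 + 20 * ν * r + 20 * r ^ 2 : ℝ) * δ * β₂ ^ 4 - (4 * ν ^ 2 * r + 4 * ν * r ^ 2 + 8 * ν * r + 8 * r ^ 2 : ℝ) * β₂ ^ 5) ^ 2 = (16 * ν ^ 4 * r + 16 * ν ^ 4 + 56 * ν ^ 3 * r ^ 2 + 152 * ν ^ 3 * r + 64 * ν ^ 3 + 56 * ν ^ 2 * r ^ 3 + 308 * ν ^ 2 * r ^ 2 + 344 * ν ^ 2 * r + 92 * ν ^ 2 + 16 * ν * r ^ 4 + 200 * ν * r ^ 3 + 432 * ν * r ^ 2 + 264 * ν * r + 48 * ν + 32 * r ^ 4 + 144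 * r ^ 3 + 160 * r ^ 2 + 48 * r : ℝ) * δ ^ 8 * β₂ ^ 2 + (80 * ν ^ 4 * r + 32 * ν ^ 4 + 264 * ν ^ 3 * r ^ 2 + 656 * ν ^ 3 * r + 208 * ν ^ 3 + 232 * ν ^ 2 * r ^ 3 + 1416 * ν ^ 2 * r ^ 2 + 1608 * ν ^ 2 * r + 408 * ν ^ 2 + 48 * ν * r ^ 4 + 864 * ν * r ^ 3 + 2176 * ν * r ^ 2 + 1360 * ν * r + 256 * ν + 96 * r ^ 4 + 736 * r ^ 3 + 896 * r ^ 2 + 256 * r : ℝ) * δ ^ 7 * β₂ ^ 3 + (12 * ν ^ 4 * r ^ 2 + 272 * ν ^ 4 * r + 48 * ν ^ 4 + 24 * ν ^ 3 * r ^ 3 + 840 * ν ^ 3 * r ^ 2 + 1912 * ν ^ 3 * r + 464 * ν ^ 3 + 12 * ν ^ 2 * r ^ 4 + 680 * ν ^ 2 * r ^ 3 + 4140 * ν ^ 2 * r ^ 2 + 4560 * ν ^ 2 * r + 1020 * ν ^ 2 + 112 * ν * r ^ 4 + 2392 * ν * r ^ 3 + 6416 * ν * r ^ 2 + 3816 *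 ν * r + 656 * ν + 176 * r ^ 4 + 2224 * r ^ 3 + 2688 * r ^ 2 + 656 * r : ℝ) * δ ^ 6 * β₂ ^ 4 + (48 * ν ^ 4 * r ^ 2 + 624 * ν ^ 4 * r + 128 * ν ^ 4 + 96 * ν ^ 3 * r ^ 3 + 1848 * ν ^ 3 * r ^ 2 + 4032 * ν ^ 3 * r + 880 * ν ^ 3 + 48 * ν ^ 2 * r ^ 4 + 1464 * ν ^ 2 * r ^ 3 + 8480 * ν ^ 2 * r ^ 2 + 8840 * ν ^ 2 * r + 1696 * ν ^ 2 + 240 * ν * r ^ 4 + 4784 * ν * r ^ 3 + 12576 * ν * r ^ 2 + 6848 * ν * r + 992 * ν + 288 * r ^ 4 + 4480 * r ^ 3 + 5056 * r ^ 2 + 992 * r : ℝ) * δ ^ 5 * β₂ ^ 5 + (72 * ν ^ 4 * r ^ 2 + 880 * ν ^ 4 * r + 192 * ν ^ 4 + 144 * ν ^ 3 * r ^ 3 + 2520 * ν ^ 3 * r ^ 2 + 5376 * ν ^ 3 * r + 1040 * ν ^ 3 + 72 * ν ^ 2 * r ^ 4 + 1944 * ν ^ 2 * r ^ 3 + 11152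 * ν ^ 2 * r ^ 2 + 10936 * ν ^ 2 * r + 1760 * ν ^ 2 + 304 * ν * r ^ 4 + 6224 * ν * r ^ 3 + 15840 * ν * r ^ 2 + 7808 * ν * r + 928 * ν + 320 * r ^ 4 + 5824 * r ^ 3 + 6016 * r ^ 2 + 928 * r : ℝ) * δ ^ 4 * β₂ ^ 6 + (48 * ν ^ 4 * r ^ 2 + 768 * ν ^ 4 * r + 128 * ν ^ 4 + 96 * ν ^ 3 * r ^ 3 + 2112 * ν ^ 3 * r ^ 2 + 4416 * ν ^ 3 * r + 640 * ν ^ 3 + 48 * ν ^ 2 * r ^ 4 + 1536 * ν ^ 2 * r ^ 3 + 9248 * ν ^ 2 * r ^ 2 + 8384 * ν ^ 2 * r + 1024 * ν ^ 2 + 192 * ν * r ^ 4 + 5120 * ν * r ^ 3 + 12672 * ν * r ^ 2 + 5504 * ν * r + 512 * ν + 192 * r ^ 4 + 4864 * r ^ 3 + 4480 * r ^ 2 + 512 * r : ℝ) * δ ^ 3 * β₂ ^ 7 + (12 * ν ^ 4 * r ^ 2 + 432 * ν ^ 4 * r + 32 * ν ^ 4 + 24 * ν ^ 3 * r ^ 3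 + 1128 * ν ^ 3 * r ^ 2 + 2304 * ν ^ 3 * r + 160 * ν ^ 3 + 12 * ν ^ 2 * r ^ 4 + 744 * ν ^ 2 * r ^ 3 + 4952 * ν ^ 2 * r ^ 2 + 4016 * ν ^ 2 * r + 256 * ν ^ 2 + 48 * ν * r ^ 4 + 2720 * ν * r ^ 3 + 6528 * ν * r ^ 2 + 2336 * ν * r + 128 * ν + 48 * r ^ 4 + 2656 * r ^ 3 + 2080 * r ^ 2 + 128 * r : ℝ) * δ ^ 2 * β₂ ^ 8 + (160 * ν ^ 4 * r + 400 * ν ^ 3 * r ^ 2 + 800 * ν ^ 3 * r + 240 * ν ^ 2 * r ^ 3 + 1760 * ν ^ 2 * r ^ 2 + 1280 * ν ^ 2 * r + 960 * ν * r ^ 3 + 2240 * ν * r ^ 2 + 640 * ν * r + 960 * r ^ 3 + 640 * r ^ 2 : ℝ) * δ * β₂ ^ 9 + (32 * ν ^ 4 * r + 80 * ν ^ 3 * r ^ 2 + 160 * ν ^ 3 * r + 48 * ν ^ 2 * r ^ 3 + 352 * ν ^ 2 * r ^ 2 + 256 * ν ^ 2 * r + 192 * ν * r ^ 3 + 448 *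 ν * r ^ 2 + 128 * ν * r + 192 * r ^ 3 + 128 * r ^ 2 : ℝ) * β₂ ^ 10 by ring]
  positivity

/-- Splitting of `P₁₀₅` (with `β₃ = β₂ + δ`, `k = ν + 1`) into `δ²·(square) + (R₂b² + R₁b + R₀)`. -/
theorem p105_split (b β₂ δ r ν : ℝ) :
    b ^ 4 * β₂ ^ 2 - 2 * b ^ 4 * β₂ * (β₂ + δ) + b ^ 4 * (β₂ + δ) ^ 2 - 2 * (r - 1) * b ^ 3 * β₂ ^ 3 + 2 * (r - 1) * b ^ 3 * β₂ ^ 2 * (β₂ + δ) + 2 * (r - 1) * b ^ 3 * β₂ * (β₂ + δ) ^ 2 - 2 * (r - 1) * b ^ 3 * (β₂ + δ) ^ 3 + (r + 1) * (2 * (ν + 1) + r + 1) * b ^ 2 * β₂ ^ 4 + 2 * ((ν + 1) * r - 3 * (ν + 1) + r ^ 2 - 4 * r + 1) * b ^ 2 * β₂ ^ 3 * (β₂ + δ) - 2 * (3 * (ν + 1) * r - 4 * (ν + 1) + 3 * r ^ 2 - 7 * r + 3) * b ^ 2 * β₂ ^ 2 * (β₂ + δ) ^ 2 + 2 * ((ν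 + 1) * r - 3 * (ν + 1) + r ^ 2 - 4 * r + 1) * b ^ 2 * β₂ * (β₂ + δ) ^ 3 + (r + 1) * (2 * (ν + 1) + r + 1) * b ^ 2 * (β₂ + δ) ^ 4 - 2 * (r + 1) * ((ν + 1) + r - 1) * (2 * (ν + 1) + r + 1) * b * β₂ ^ 4 * (β₂ + δ) + 2 * ((ν + 1) + r - 1) * ((ν + 1) * r + 2 * (ν + 1) + r ^ 2 + r + 1) * b * β₂ ^ 3 * (β₂ + δ) ^ 2 + 2 * ((ν + 1) + r - 1) * ((ν + 1) * r + 2 * (ν + 1) + r ^ 2 + r + 1) * b * β₂ ^ 2 * (β₂ + δ) ^ 3 - 2 * (r + 1) * ((ν + 1) + r - 1) * (2 * (ν + 1) + r + 1) * b * β₂ * (β₂ + δ) ^ 4 + ((ν + 1) + r) * (r + 2) * ((ν + 1) + r - 1) * (2 * (ν + 1) + r + 1) * β₂ ^ 4 * (β₂ + δ) ^ 2 - 2 * ((ν + 1) + r) ^ 2 * (r + 2) * ((ν + 1) + r - 1) * β₂ ^ 3 * (β₂ + δ) ^ 3 + ((ν + 1) + r) * (r + 2) * ((ν + 1) + r -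 1) * (2 * (ν + 1) + r + 1) * β₂ ^ 2 * (β₂ + δ) ^ 4
      = δ ^ 2 * (b ^ 2 - 2 * (r - 1) * b * β₂ - (r - 1) * b * δ + r * (ν + r + 1) * β₂ ^ 2 + r * (ν + r + 1) * β₂ * δ) ^ 2 + (((2 * ν * r + 2 * ν + 6 * r + 2 : ℝ) * δ ^ 4 + (8 * ν * r + 2 * ν + 16 * r + 4 : ℝ) * δ ^ 3 * β₂ + (10 * ν * r + 2 * ν + 20 * r + 4 : ℝ) * δ ^ 2 * β₂ ^ 2 + (4 * ν * r + 8 * r : ℝ) * δ * β₂ ^ 3 + (2 * ν * r + 4 * r : ℝ) * β₂ ^ 4) * b ^ 2 + (-(4 * ν ^ 2 * r + 4 * ν ^ 2 + 4 * ν * r ^ 2 + 14 * ν * r + 6 * ν + 8 * r ^ 2 + 8 * r : ℝ) * δ ^ 4 * β₂ - (14 * ν ^ 2 * r + 12 * ν ^ 2 + 14 * ν * r ^ 2 + 46 * ν * r + 18 * ν + 28 * r ^ 2 + 24 * r : ℝ) * δ ^ 3 * β₂ ^ 2 - (16 * ν ^ 2 * r + 8 * ν ^ 2 + 16 * ν *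 r ^ 2 + 44 * ν * r + 12 * ν + 32 * r ^ 2 + 16 * r : ℝ) * δ ^ 2 * β₂ ^ 3 - (10 * ν ^ 2 * r + 10 * ν * r ^ 2 + 20 * ν * r + 20 * r ^ 2 : ℝ) * δ * β₂ ^ 4 - (4 * ν ^ 2 * r + 4 * ν * r ^ 2 + 8 * ν * r + 8 * r ^ 2 : ℝ) * β₂ ^ 5) * b + ((2 * ν ^ 3 * r + 4 * ν ^ 3 + 4 * ν ^ 2 * r ^ 2 + 15 * ν ^ 2 * r + 10 * ν ^ 2 + 2 * ν * r ^ 3 + 15 * ν * r ^ 2 + 21 * ν * r + 6 * ν + 4 * r ^ 3 + 10 * r ^ 2 + 6 * r : ℝ) * δ ^ 4 * β₂ ^ 2 + (6 * ν ^ 3 * r + 12 * ν ^ 3 + 12 * ν ^ 2 * r ^ 2 + 44 * ν ^ 2 * r + 32 * ν ^ 2 + 6 * ν * r ^ 3 + 44 * ν * r ^ 2 + 66 * ν * r + 20 * ν + 12 * r ^ 3 + 32 * r ^ 2 + 20 * r : ℝ) * δ ^ 3 * β₂ ^ 3 + (8 * ν ^ 3 * r + 16 * ν ^ 3 + 16 *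 ν ^ 2 * r ^ 2 + 57 * ν ^ 2 * r + 46 * ν ^ 2 + 8 * ν * r ^ 3 + 57 * ν * r ^ 2 + 93 * ν * r + 30 * ν + 16 * r ^ 3 + 46 * r ^ 2 + 30 * r : ℝ) * δ ^ 2 * β₂ ^ 4 + (6 * ν ^ 3 * r + 12 * ν ^ 3 + 12 * ν ^ 2 * r ^ 2 + 42 * ν ^ 2 * r + 36 * ν ^ 2 + 6 * ν * r ^ 3 + 42 * ν * r ^ 2 + 72 * ν * r + 24 * ν + 12 * r ^ 3 + 36 * r ^ 2 + 24 * r : ℝ) * δ * β₂ ^ 5 + (2 * ν ^ 3 * r + 4 * ν ^ 3 + 4 * ν ^ 2 * r ^ 2 + 14 * ν ^ 2 * r + 12 * ν ^ 2 + 2 * ν * r ^ 3 + 14 * ν * r ^ 2 + 24 * ν * r + 8 * ν + 4 * r ^ 3 + 12 * r ^ 2 + 8 * r : ℝ) * β₂ ^ 6)) := by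
  ring

/-- `P₁₀₅(k) > 0` for `k ≥ 1` when `β₂ ≤ β₃` (the stage-4/5 pivot family). -/
theorem p105_pos_of_le (b β₂ β₃ r k : ℝ) (h₂ : 0 < β₂) (hle : β₂ ≤ β₃) (hr : 0 < r) (hk : 1 ≤ k) :
    0 < b ^ 4 * β₂ ^ 2 - 2 * b ^ 4 * β₂ * β₃ + b ^ 4 * β₃ ^ 2 - 2 * (r - 1) * b ^ 3 * β₂ ^ 3 + 2 * (r - 1) * b ^ 3 * β₂ ^ 2 * β₃ + 2 * (r - 1) * b ^ 3 * β₂ * β₃ ^ 2 - 2 * (r - 1) * b ^ 3 * β₃ ^ 3 + (r + 1) * (2 * k + r + 1) * b ^ 2 * β₂ ^ 4 + 2 * (k * r - 3 * k + r ^ 2 - 4 * r + 1) * b ^ 2 * β₂ ^ 3 * β₃ - 2 * (3 * k * r - 4 * k + 3 * r ^ 2 - 7 * r + 3) * b ^ 2 * β₂ ^ 2 * β₃ ^ 2 + 2 * (k * r - 3 * k + r ^ 2 - 4 * r + 1) * b ^ 2 * β₂ * β₃ ^ 3 + (r + 1) * (2 * k + r + 1) * b ^ 2 * β₃ ^ 4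 - 2 * (r + 1) * (k + r - 1) * (2 * k + r + 1) * b * β₂ ^ 4 * β₃ + 2 * (k + r - 1) * (k * r + 2 * k + r ^ 2 + r + 1) * b * β₂ ^ 3 * β₃ ^ 2 + 2 * (k + r - 1) * (k * r + 2 * k + r ^ 2 + r + 1) * b * β₂ ^ 2 * β₃ ^ 3 - 2 * (r + 1) * (k + r - 1) * (2 * k + r + 1) * b * β₂ * β₃ ^ 4 + (k + r) * (r + 2) * (k + r - 1) * (2 * k + r + 1) * β₂ ^ 4 * β₃ ^ 2 - 2 * (k + r) ^ 2 * (r + 2) * (k + r - 1) * β₂ ^ 3 * β₃ ^ 3 + (k + r) * (r + 2) * (k + r - 1) * (2 * k + r + 1) * β₂ ^ 2 * β₃ ^ 4 := by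
  obtain ⟨δ, hδ, rfl⟩ : ∃ δ, 0 ≤ δ ∧ β₃ = β₂ + δ := ⟨β₃ - β₂, sub_nonneg.2 hle, by ring⟩
  obtain ⟨ν, hν, rfl⟩ : ∃ ν, 0 ≤ ν ∧ k = ν + 1 := ⟨k - 1, by linarith, by ring⟩
  have hR2 : 0 < (2 * ν * r + 2 * ν + 6 * r + 2 : ℝ) * δ ^ 4 + (8 * ν * r + 2 * ν + 16 * r + 4 : ℝ) * δ ^ 3 * β₂ + (10 * ν * r + 2 * ν + 20 * r + 4 : ℝ) * δ ^ 2 * β₂ ^ 2 + (4 * ν * r + 8 * r : ℝ) * δ * β₂ ^ 3 + (2 * ν * r + 4 * r : ℝ) * β₂ ^ 4 := by positivity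
  have hq := quad_pos _ _ _ b hR2 (p105_disc_pos δ β₂ ν r hδ h₂ hν hr)
  rw [p105_split]
  exact add_pos_of_nonneg_of_pos (by positivity) hq

/-- `P₁₀₅(k) > 0` for `k ≥ 1` (symmetric in `β₂ ↔ β₃`). -/
theorem p105_pos (b β₂ β₃ r k : ℝ) (h₂ : 0 < β₂) (h₃ : 0 < β₃) (hr : 0 < r) (hk : 1 ≤ k) :
    0 < b ^ 4 * β₂ ^ 2 - 2 * b ^ 4 * β₂ * β₃ + b ^ 4 * β₃ ^ 2 - 2 * (r - 1) * b ^ 3 * β₂ ^ 3 + 2 * (r - 1) * b ^ 3 * β₂ ^ 2 * β₃ + 2 * (r - 1) * b ^ 3 * β₂ * β₃ ^ 2 - 2 * (r - 1) * b ^ 3 * β₃ ^ 3 + (r + 1) * (2 * k + r + 1) * b ^ 2 * β₂ ^ 4 + 2 * (k * r - 3 * k + r ^ 2 - 4 * r + 1) * b ^ 2 * β₂ ^ 3 * β₃ - 2 * (3 * k * r - 4 * k + 3 * r ^ 2 - 7 * r + 3) * b ^ 2 * β₂ ^ 2 * β₃ ^ 2 + 2 * (k * r - 3 * k + r ^ 2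 - 4 * r + 1) * b ^ 2 * β₂ * β₃ ^ 3 + (r + 1) * (2 * k + r + 1) * b ^ 2 * β₃ ^ 4 - 2 * (r + 1) * (k + r - 1) * (2 * k + r + 1) * b * β₂ ^ 4 * β₃ + 2 * (k + r - 1) * (k * r + 2 * k + r ^ 2 + r + 1) * b * β₂ ^ 3 * β₃ ^ 2 + 2 * (k + r - 1) * (k * r + 2 * k + r ^ 2 + r + 1) * b * β₂ ^ 2 * β₃ ^ 3 - 2 * (r + 1) * (k + r - 1) * (2 * k + r + 1) * b * β₂ * β₃ ^ 4 + (k + r) * (r + 2) * (k + r - 1) * (2 * k + r + 1) * β₂ ^ 4 * β₃ ^ 2 - 2 * (k + r) ^ 2 * (r + 2) * (k + r - 1) * β₂ ^ 3 * β₃ ^ 3 + (k + r) * (r + 2) * (k + r - 1) * (2 * k + r + 1) * β₂ ^ 2 * β₃ ^ 4 := by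
  rcases le_or_gt β₂ β₃ with hle | hlt
  · exact p105_pos_of_le b β₂ β₃ r k h₂ hle hr hk
  · linarith [p105_pos_of_le b β₃ β₂ r k h₃ hlt.le hr hk]

/-- `P₆₉(k) > 0` for `k ≥ 2`, `b > 0`: the deepest pivot family (`(β₂-β₃)²P₆₉/P₁₀₅` is the last
`W`-type pivot), via two nested discriminants: `P₆₉ = Uβ₃² + Vβ₃ + W`, `4UW - V² = 4b²(k+2r)(k+r-1)Ψ`,
`Ψ = r(b² - (2k+2r-3)bβ₂ + (k+r-1)(k+r-2)β₂²)² + Q`, `Q` a quadratic form of negative discriminant. -/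
theorem p69_pos (b β₂ β₃ r k : ℝ) (hb : 0 < b) (h₂ : 0 < β₂) (hr : 0 < r) (hk : 2 ≤ k) :
    0 < r * b ^ 4 - 2 * r * (k + r - 1) * b ^ 3 * β₂ - 2 * r * (k + r - 1) * b ^ 3 * β₃ + (k + r) * (r + 1) * (k + r - 1) * b ^ 2 * β₂ ^ 2 + 2 * r * (k + r - 1) * (2 * k + 2 * r - 3) * b ^ 2 * β₂ * β₃ + (k + r) * (r + 1) * (k + r - 1) * b ^ 2 * β₃ ^ 2 - 2 * (k + r) * (r + 1) * (k + r - 2) * (k + r - 1) * b * β₂ ^ 2 * β₃ - 2 * (k + r) * (r + 1) * (k + r - 2) * (k + r - 1) * b * β₂ * β₃ ^ 2 + (k + r) * (r + 2) * (k + r - 2) * (k + r - 1) ^ 2 * β₂ ^ 2 * β₃ ^ 2 := by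
  obtain ⟨ν, hν, rfl⟩ : ∃ ν, 0 ≤ ν ∧ k = ν + 2 := ⟨k - 2, by linarith, by ring⟩
  have hQd : 0 < (ν ^ 2 + 5 * ν * r + 3 * ν + 4 * r ^ 2 + 5 * r + 2) * b ^ 2 * β₂ ^ 2 + (-2 * (ν + r) * (ν + r + 1) * (ν + 4 * r + 2)) * b * β₂ ^ 3 + ((ν + r) * (ν + r + 1) * (ν ^ 2 + 5 * ν * r + 4 * ν + 4 * r ^ 2 + 8 * r + 4)) * β₂ ^ 4 := by
    have h4 : 0 < ((ν ^ 2 + 5 * ν * r + 3 * ν + 4 * r ^ 2 + 5 * r + 2) * b ^ 2 * β₂ ^ 2 + (-2 * (ν + r) * (ν + r + 1) * (ν + 4 * r + 2)) * b * β₂ ^ 3 + ((ν + r) * (ν + r + 1) * (ν ^ 2 + 5 * ν * r + 4 * ν + 4 * r ^ 2 + 8 * r + 4)) * β₂ ^ 4) * (4 * (ν ^ 2 + 5 * ν * r + 3 * ν + 4 * r ^ 2 + 5 * r + 2)) := by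
      rw [show ((ν ^ 2 + 5 * ν * r + 3 * ν + 4 * r ^ 2 + 5 * r + 2) * b ^ 2 * β₂ ^ 2 + (-2 * (ν + r) * (ν + r + 1) * (ν + 4 * r + 2)) * b * β₂ ^ 3 + ((ν + r) * (ν + r + 1) * (ν ^ 2 + 5 * ν * r + 4 * ν + 4 * r ^ 2 + 8 * r + 4)) * β₂ ^ 4) * (4 * (ν ^ 2 + 5 * ν * r + 3 * ν + 4 * r ^ 2 + 5 * r + 2)) = (2 * (ν ^ 2 + 5 * ν * r + 3 * ν + 4 * r ^ 2 + 5 * r + 2) * b * β₂ + (-2 * (ν + r) * (ν + r + 1) * (ν + 4 * r + 2)) * β₂ ^ 2) ^ 2 + (8 * ν ^ 5 + (76 * r + 48 : ℝ) * ν ^ 4 + (260 * r ^ 2 + 332 * r + 104 : ℝ) * ν ^ 3 + (404 * r ^ 3 + 776 * r ^ 2 + 480 * r + 96 : ℝ) * ν ^ 2 + (292 * r ^ 4 + 748 * r ^ 3 + 680 * r ^ 2 + 256 * r + 32 : ℝ) * ν + (80 * r ^ 5 + 256 * r ^ 4 + 304 * r ^ 3 + 160 * r ^ 2 + 32 * r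 : ℝ)) * β₂ ^ 4 by ring]; positivity
    exact pos_of_mul_pos_left h4 (by positivity)
  have hU : 0 < (r + 1) * (ν + r + 1) * (ν + r + 2) * b ^ 2 - 2 * (ν + r) * (r + 1) * (ν + r + 1) * (ν + r + 2) * b * β₂ + (ν + r) * (r + 2) * (ν + r + 1) ^ 2 * (ν + r + 2) * β₂ ^ 2 := by
    rw [show (r + 1) * (ν + r + 1) * (ν + r + 2) * b ^ 2 - 2 * (ν + r) * (r + 1) * (ν + r + 1) * (ν + r + 2) * b * β₂ + (ν + r) * (r + 2) * (ν + r + 1) ^ 2 * (ν + r + 2) * β₂ ^ 2 = (ν + r + 1) * (ν + r + 2) * ((r + 1) * (b - (ν + r) * β₂) ^ 2 + (ν + r) * (ν + 2 * r + 2) * β₂ ^ 2) by ring]; positivity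
  have h4 : 0 < (r * b ^ 4 - 2 * r * ((ν + 2) + r - 1) * b ^ 3 * β₂ - 2 * r * ((ν + 2) + r - 1) * b ^ 3 * β₃ + ((ν + 2) + r) * (r + 1) * ((ν + 2) + r - 1) * b ^ 2 * β₂ ^ 2 + 2 * r * ((ν + 2) + r - 1) * (2 * (ν + 2) + 2 * r - 3) * b ^ 2 * β₂ * β₃ + ((ν + 2) + r) * (r + 1) * ((ν + 2) + r - 1) * b ^ 2 * β₃ ^ 2 - 2 * ((ν + 2) + r) * (r + 1) * ((ν + 2) + r - 2) * ((ν + 2) + r - 1) * b * β₂ ^ 2 * β₃ - 2 * ((ν + 2) + r) * (r + 1) * ((ν + 2) + r - 2) * ((ν + 2) + r - 1) * b * β₂ * β₃ ^ 2 + ((ν + 2) + r) * (r + 2) * ((ν + 2) + r - 2) * ((ν + 2) + r - 1) ^ 2 * β₂ ^ 2 * β₃ ^ 2) * (4 * ((r + 1) * (ν + r + 1) * (ν + r + 2) * b ^ 2 - 2 * (ν + r) * (r + 1) * (ν + r + 1) * (ν + r + 2) * b * β₂ + (ν + r) * (r + 2) * (ν + r + 1) ^ 2 * (ν + r + 2)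 * β₂ ^ 2)) := by
    rw [show (r * b ^ 4 - 2 * r * ((ν + 2) + r - 1) * b ^ 3 * β₂ - 2 * r * ((ν + 2) + r - 1) * b ^ 3 * β₃ + ((ν + 2) + r) * (r + 1) * ((ν + 2) + r - 1) * b ^ 2 * β₂ ^ 2 + 2 * r * ((ν + 2) + r - 1) * (2 * (ν + 2) + 2 * r - 3) * b ^ 2 * β₂ * β₃ + ((ν + 2) + r) * (r + 1) * ((ν + 2) + r - 1) * b ^ 2 * β₃ ^ 2 - 2 * ((ν + 2) + r) * (r + 1) * ((ν + 2) + r - 2) * ((ν + 2) + r - 1) * b * β₂ ^ 2 * β₃ - 2 * ((ν + 2) + r) * (r + 1) * ((ν + 2) + r - 2) * ((ν + 2) + r - 1) * b * β₂ * β₃ ^ 2 + ((ν + 2) + r) * (r + 2) * ((ν + 2) + r - 2) * ((ν + 2) + r - 1) ^ 2 * β₂ ^ 2 * β₃ ^ 2) * (4 * ((r + 1) * (ν + r + 1) * (ν + r + 2) * b ^ 2 - 2 * (ν + r) * (r + 1) * (ν + r + 1) * (ν + r + 2) * b * β₂ + (ν + r) * (r + 2) * (ν + r + 1) ^ 2 *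 (ν + r + 2) * β₂ ^ 2)) = (2 * ((r + 1) * (ν + r + 1) * (ν + r + 2) * b ^ 2 - 2 * (ν + r) * (r + 1) * (ν + r + 1) * (ν + r + 2) * b * β₂ + (ν + r) * (r + 2) * (ν + r + 1) ^ 2 * (ν + r + 2) * β₂ ^ 2) * β₃ + (-2 * r * (ν + r + 1) * b ^ 3 + 2 * r * (ν + r + 1) * (2 * ν + 2 * r + 1) * b ^ 2 * β₂ - 2 * (ν + r) * (r + 1) * (ν + r + 1) * (ν + r + 2) * b * β₂ ^ 2)) ^ 2 + 4 * b ^ 2 * (ν + 2 + 2 * r) * (ν + r + 1) * (r * (b ^ 2 - (2 * ν + 2 * r + 1) * b * β₂ + (ν + r + 1) * (ν + r) * β₂ ^ 2) ^ 2 + ((ν ^ 2 + 5 * ν * r + 3 * ν + 4 * r ^ 2 + 5 * r + 2) * b ^ 2 * β₂ ^ 2 + (-2 * (ν + r) * (ν + r + 1) * (ν + 4 * r + 2)) * b * β₂ ^ 3 + ((ν + r) * (ν + r + 1) * (ν ^ 2 + 5 * ν * r + 4 * ν + 4 * r ^ 2 + 8 * r + 4)) * β₂ ^ 4)) by ring]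
    exact add_pos_of_nonneg_of_pos (sq_nonneg _) (by positivity)
  exact pos_of_mul_pos_left h4 (by positivity)

/-- The boundary quadratic `X = (β₂+β₃)b² - 4rβ₂β₃b + (r+1)(r+2)β₂β₃(β₂+β₃) > 0`. -/
theorem boundaryX_pos (b β₂ β₃ r : ℝ) (h₂ : 0 < β₂) (h₃ : 0 < β₃) (hr : 0 < r) :
    0 < b ^ 2 * β₂ + b ^ 2 * β₃ - 4 * r * b * β₂ * β₃ + (r + 1) * (r + 2) * β₂ ^ 2 * β₃ + (r + 1) * (r + 2) * β₂ * β₃ ^ 2 := by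
  have h4 : 0 < (b ^ 2 * β₂ + b ^ 2 * β₃ - 4 * r * b * β₂ * β₃ + (r + 1) * (r + 2) * β₂ ^ 2 * β₃ + (r + 1) * (r + 2) * β₂ * β₃ ^ 2) * (4 * (β₂ + β₃)) := by
    rw [show (b ^ 2 * β₂ + b ^ 2 * β₃ - 4 * r * b * β₂ * β₃ + (r + 1) * (r + 2) * β₂ ^ 2 * β₃ + (r + 1) * (r + 2) * β₂ * β₃ ^ 2) * (4 * (β₂ + β₃)) = (2 * (β₂ + β₃) * b - 4 * r * β₂ * β₃) ^ 2 + 4 * β₂ * β₃ * ((β₂ + β₃) ^ 2 * (3 * r + 2) + r ^ 2 * (β₂ - β₃) ^ 2) by ring]; positivity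
  exact pos_of_mul_pos_left h4 (by positivity)
set_option maxHeartbeats 1000000 in -- polynomial identity behind the stage-4 closed form (`ring`)
set_option maxRecDepth 4000 in
/-- Stage-4 identity `F₂₁(k)·P₃₆(k) - D₂(k)·P₂₀(k) = K₁·P₁₀₅(k)`. -/
theorem stage4_id (b β₂ β₃ r k : ℝ) :
    (b ^ 2 * β₂ + b ^ 2 * β₃ + (2 * k + r + 1) * b * β₂ ^ 2 - 2 * (k + 3 * r - 2) * b * β₂ * β₃ + (2 * k + r + 1) * b * β₃ ^ 2 + (r + 2) * (2 * k + r + 1) * β₂ ^ 2 * β₃ + (r + 2) * (2 * k + r + 1) * β₂ * β₃ ^ 2) * (b ^ 3 * β₂ ^ 2 - 2 * b ^ 3 * β₂ * β₃ + b ^ 3 * β₃ ^ 2 + (r + 1) * b ^ 2 * β₂ ^ 3 - b ^ 2 * β₂ ^ 2 * β₃ - b ^ 2 * β₂ * β₃ ^ 2 + (r + 1) * b ^ 2 * β₃ ^ 3 - 2 * (r + 1) * (k + r - 1) * b * β₂ ^ 3 * β₃ + 4 * (k + r - 1) * b * β₂ ^ 2 * β₃ ^ 2 - 2 * (r + 1)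 * (k + r - 1) * b * β₂ * β₃ ^ 3 + (k + r) * (r + 2) * (k + r - 1) * β₂ ^ 3 * β₃ ^ 2 + (k + r) * (r + 2) * (k + r - 1) * β₂ ^ 2 * β₃ ^ 3) - (2 * b ^ 2 * β₂ ^ 2 - 2 * b ^ 2 * β₂ * β₃ + 2 * b ^ 2 * β₃ ^ 2 - 2 * (r - 1) * b * β₂ ^ 2 * β₃ - 2 * (r - 1) * b * β₂ * β₃ ^ 2 + (r + 2) * (3 * k + 2 * r + 1) * β₂ ^ 2 * β₃ ^ 2) * ((k + 2 * r) * b ^ 2 * β₂ ^ 2 - 2 * (k + r) * b ^ 2 * β₂ * β₃ + (k + 2 * r) * b ^ 2 * β₃ ^ 2 - 2 * r * (k + r - 1) * b * β₂ ^ 2 * β₃ - 2 * r * (k + r - 1) * b * β₂ * β₃ ^ 2 + 2 * (k + r) * (r + 2) * (k + r - 1) * β₂ ^ 2 * β₃ ^ 2)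
      = (b * β₂ + b * β₃ + (r + 2) * β₂ * β₃) * (b ^ 4 * β₂ ^ 2 - 2 * b ^ 4 * β₂ * β₃ + b ^ 4 * β₃ ^ 2 - 2 * (r - 1) * b ^ 3 * β₂ ^ 3 + 2 * (r - 1) * b ^ 3 * β₂ ^ 2 * β₃ + 2 * (r - 1) * b ^ 3 * β₂ * β₃ ^ 2 - 2 * (r - 1) * b ^ 3 * β₃ ^ 3 + (r + 1) * (2 * k + r + 1) * b ^ 2 * β₂ ^ 4 + 2 * (k * r - 3 * k + r ^ 2 - 4 * r + 1) * b ^ 2 * β₂ ^ 3 * β₃ - 2 * (3 * k * r - 4 * k + 3 * r ^ 2 - 7 * r + 3) * b ^ 2 * β₂ ^ 2 * β₃ ^ 2 + 2 * (k * r - 3 * k + r ^ 2 - 4 * r + 1) * b ^ 2 * β₂ * β₃ ^ 3 + (r + 1) * (2 * k + r + 1) * b ^ 2 * β₃ ^ 4 - 2 * (r + 1) * (k + r - 1) * (2 * k + r + 1) * b * β₂ ^ 4 * β₃ + 2 * (k + r - 1) * (k * r + 2 * k + r ^ 2 + r + 1) * b * β₂ ^ 3 * β₃ ^ 2 + 2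 * (k + r - 1) * (k * r + 2 * k + r ^ 2 + r + 1) * b * β₂ ^ 2 * β₃ ^ 3 - 2 * (r + 1) * (k + r - 1) * (2 * k + r + 1) * b * β₂ * β₃ ^ 4 + (k + r) * (r + 2) * (k + r - 1) * (2 * k + r + 1) * β₂ ^ 4 * β₃ ^ 2 - 2 * (k + r) ^ 2 * (r + 2) * (k + r - 1) * β₂ ^ 3 * β₃ ^ 3 + (k + r) * (r + 2) * (k + r - 1) * (2 * k + r + 1) * β₂ ^ 2 * β₃ ^ 4) := by
  ring

set_option maxHeartbeats 4000000 in -- polynomial identity behind the stage-5 closed form (`ring`)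
set_option maxRecDepth 8000 in
/-- Stage-5 identity `P₂₀(k+1)·P₁₀₅(k) - (k+1)·P₃₆(k)·P₃₆(k+1) = (β₂-β₃)²·D₂(k)·P₆₉(k+1)`. -/
theorem stage5_id (b β₂ β₃ r k : ℝ) :
    (((k + 1) + 2 * r) * b ^ 2 * β₂ ^ 2 - 2 * ((k + 1) + r) * b ^ 2 * β₂ * β₃ + ((k + 1) + 2 * r) * b ^ 2 * β₃ ^ 2 - 2 * r * ((k + 1) + r - 1) * b * β₂ ^ 2 * β₃ - 2 * r * ((k + 1) + r - 1) * b * β₂ * β₃ ^ 2 + 2 * ((k + 1) + r) * (r + 2) * ((k + 1) + r - 1) * β₂ ^ 2 * β₃ ^ 2) * (b ^ 4 * β₂ ^ 2 - 2 * b ^ 4 * β₂ * β₃ + b ^ 4 * β₃ ^ 2 - 2 * (r - 1) * b ^ 3 * β₂ ^ 3 + 2 * (r - 1) * b ^ 3 * β₂ ^ 2 * β₃ + 2 * (r - 1) * b ^ 3 * β₂ * β₃ ^ 2 - 2 * (r - 1) * b ^ 3 * β₃ ^ 3 + (r + 1) * (2 * k + r + 1) * b ^ 2 * β₂ ^ 4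 + 2 * (k * r - 3 * k + r ^ 2 - 4 * r + 1) * b ^ 2 * β₂ ^ 3 * β₃ - 2 * (3 * k * r - 4 * k + 3 * r ^ 2 - 7 * r + 3) * b ^ 2 * β₂ ^ 2 * β₃ ^ 2 + 2 * (k * r - 3 * k + r ^ 2 - 4 * r + 1) * b ^ 2 * β₂ * β₃ ^ 3 + (r + 1) * (2 * k + r + 1) * b ^ 2 * β₃ ^ 4 - 2 * (r + 1) * (k + r - 1) * (2 * k + r + 1) * b * β₂ ^ 4 * β₃ + 2 * (k + r - 1) * (k * r + 2 * k + r ^ 2 + r + 1) * b * β₂ ^ 3 * β₃ ^ 2 + 2 * (k + r - 1) * (k * r + 2 * k + r ^ 2 + r + 1) * b * β₂ ^ 2 * β₃ ^ 3 - 2 * (r + 1) * (k + r - 1) * (2 * k + r + 1) * b * β₂ * β₃ ^ 4 + (k + r) * (r + 2) * (k + r - 1) * (2 * k + r + 1) * β₂ ^ 4 * β₃ ^ 2 - 2 * (k + r) ^ 2 * (r + 2) * (k + r - 1) * β₂ ^ 3 * β₃ ^ 3 + (k + r) * (r + 2) * (k + r - 1) * (2 * k + r + 1) * β₂ ^ 2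 * β₃ ^ 4) - (k + 1) * (b ^ 3 * β₂ ^ 2 - 2 * b ^ 3 * β₂ * β₃ + b ^ 3 * β₃ ^ 2 + (r + 1) * b ^ 2 * β₂ ^ 3 - b ^ 2 * β₂ ^ 2 * β₃ - b ^ 2 * β₂ * β₃ ^ 2 + (r + 1) * b ^ 2 * β₃ ^ 3 - 2 * (r + 1) * (k + r - 1) * b * β₂ ^ 3 * β₃ + 4 * (k + r - 1) * b * β₂ ^ 2 * β₃ ^ 2 - 2 * (r + 1) * (k + r - 1) * b * β₂ * β₃ ^ 3 + (k + r) * (r + 2) * (k + r - 1) * β₂ ^ 3 * β₃ ^ 2 + (k + r) * (r + 2) * (k + r - 1) * β₂ ^ 2 * β₃ ^ 3) * (b ^ 3 * β₂ ^ 2 - 2 * b ^ 3 * β₂ * β₃ + b ^ 3 * β₃ ^ 2 + (r + 1) * b ^ 2 * β₂ ^ 3 - b ^ 2 * β₂ ^ 2 * β₃ - b ^ 2 * β₂ * β₃ ^ 2 + (r + 1) * b ^ 2 * β₃ ^ 3 - 2 * (r + 1) * ((k + 1) + r - 1) * b * β₂ ^ 3 * β₃ + 4 * ((k + 1) + r -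 1) * b * β₂ ^ 2 * β₃ ^ 2 - 2 * (r + 1) * ((k + 1) + r - 1) * b * β₂ * β₃ ^ 3 + ((k + 1) + r) * (r + 2) * ((k + 1) + r - 1) * β₂ ^ 3 * β₃ ^ 2 + ((k + 1) + r) * (r + 2) * ((k + 1) + r - 1) * β₂ ^ 2 * β₃ ^ 3)
      = (β₂ - β₃) ^ 2 * (2 * b ^ 2 * β₂ ^ 2 - 2 * b ^ 2 * β₂ * β₃ + 2 * b ^ 2 * β₃ ^ 2 - 2 * (r - 1) * b * β₂ ^ 2 * β₃ - 2 * (r - 1) * b * β₂ * β₃ ^ 2 + (r + 2) * (3 * k + 2 * r + 1) * β₂ ^ 2 * β₃ ^ 2) * (r * b ^ 4 - 2 * r * ((k + 1) + r - 1) * b ^ 3 * β₂ - 2 * r * ((k + 1) + r - 1) * b ^ 3 * β₃ + ((k + 1) + r) * (r + 1) * ((k + 1) + r - 1) * b ^ 2 * β₂ ^ 2 + 2 * r * ((k + 1) + r - 1) * (2 * (k + 1) + 2 * r - 3) * b ^ 2 * β₂ * β₃ + ((k + 1) + r) * (r + 1) * ((k + 1) + r - 1) * b ^ 2 * β₃ ^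 2 - 2 * ((k + 1) + r) * (r + 1) * ((k + 1) + r - 2) * ((k + 1) + r - 1) * b * β₂ ^ 2 * β₃ - 2 * ((k + 1) + r) * (r + 1) * ((k + 1) + r - 2) * ((k + 1) + r - 1) * b * β₂ * β₃ ^ 2 + ((k + 1) + r) * (r + 2) * ((k + 1) + r - 2) * ((k + 1) + r - 1) ^ 2 * β₂ ^ 2 * β₃ ^ 2) := by
  ring

set_option maxHeartbeats 4000000 in -- seven stages of `field_simp`/`ring` bookkeeping
set_option maxRecDepth 8000 in
/-- **CONJECTURE R at the vertex (1,0,0).**  The operator Hurwitz matrix (doubled kernel: rows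
`2k ↦ W(k,·)`, `2k+1 ↦ C(k,·)`, `C(k,l) = W(k+1,l) - W(k,l-1)`) of
`W = (Θ_b + r)(β₂D + 1)(β₃D + 1)` — bands `κ₀(k) = k + r`, `κ₁(k) = k(b + (β₂+β₃)(k+r))`,
`κ₂(k) = k(k-1)(b(β₂+β₃) + β₂β₃(k+r))`, `κ₃(k) = bβ₂β₃k(k-1)(k-2)` — is totally nonnegative for
`b, β₂, β₃, r > 0`, `β₂ ≠ β₃`. -/
theorem neutralTwoClassical_hurwitz_tn (b β₂ β₃ r : ℝ) (hb : 0 < b) (h₂ : 0 < β₂) (h₃ : 0 < β₃)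
    (hne : β₂ ≠ β₃) (hr : 0 < r) (κ₀ κ₁ κ₂ κ₃ : ℕ → ℝ)
    (hκ₀ : ∀ k : ℕ, κ₀ k = (k : ℝ) + r)
    (hκ₁ : ∀ k : ℕ, κ₁ k = (k : ℝ) * (b + (β₂ + β₃) * ((k : ℝ) + r)))
    (hκ₂ : ∀ k : ℕ, κ₂ k = (k : ℝ) * ((k : ℝ) - 1) * (b * (β₂ + β₃) + β₂ * β₃ * ((k : ℝ) + r)))
    (hκ₃ : ∀ k : ℕ, κ₃ k = b * β₂ * β₃ * ((k : ℝ) * ((k : ℝ) - 1) * ((k : ℝ) - 2)))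
    {m : ℕ} (ρ γ : Fin m → ℕ) (hρ : StrictMono ρ) (hγ : StrictMono γ) :
    0 ≤ (Matrix.of fun i j =>
      if ρ i % 2 = 0 then
        (if γ j = ρ i / 2 then κ₀ (ρ i / 2) else if γ j + 1 = ρ i / 2 then κ₁ (ρ i / 2)
          else if γ j + 2 = ρ i / 2 then κ₂ (ρ i / 2)
          else if γ j + 3 = ρ i / 2 then κ₃ (ρ i / 2) else 0)
      else
        (if γ j = ρ i / 2 + 1 then κ₀ (ρ i / 2 + 1) - κ₀ (ρ i / 2)
          else if γ j = ρ i / 2 then κ₁ (ρ i / 2 + 1) - κ₁ (ρ i / 2)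
          else if γ j + 1 = ρ i / 2 then κ₂ (ρ i / 2 + 1) - κ₂ (ρ i / 2)
          else if γ j + 2 = ρ i / 2 then κ₃ (ρ i / 2 + 1) - κ₃ (ρ i / 2) else 0)).det := by
  -- one elimination stage on the doubled index (cf. `HurwitzPair.interleave_step` / `step_tn`)
  have stage : ∀ (X Y X' Y' : ℕ → ℕ → ℝ) (eE eO : ℕ → ℝ),
      (∀ l, X 0 l = X' 0 l) → (∀ k l, X (k + 1) l = X' (k + 1) l + eE (k + 1) * Y' k l) →
      (∀ k l, Y k l = Y' k l + eO k * X' k l) → eE 0 = 0 → (∀ k, 0 ≤ eE k) → (∀ k, 0 ≤ eO k) →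
      (∀ (n : ℕ) (ρ' γ' : Fin n → ℕ), StrictMono ρ' → StrictMono γ' →
        0 ≤ (Matrix.of fun i j =>
          (if ρ' i % 2 = 0 then X' (ρ' i / 2) (γ' j) else Y' (ρ' i / 2) (γ' j))).det) →
      ∀ (n : ℕ) (ρ' γ' : Fin n → ℕ), StrictMono ρ' → StrictMono γ' →
        0 ≤ (Matrix.of fun i j =>
          (if ρ' i % 2 = 0 then X (ρ' i / 2) (γ' j) else Y (ρ' i / 2) (γ' j))).det := by
    intro X Y X' Y' eE eO h0 hE hO he0 heE heO hTN n ρ' γ' hρ' hγ'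
    let R' : ℕ → ℕ → ℝ := fun t l => if t % 2 = 0 then X' (t / 2) l else Y' (t / 2) l
    let e : ℕ → ℝ := fun t => if t % 2 = 0 then eE (t / 2) else eO (t / 2)
    have heq : (Matrix.of fun i j =>
          (if ρ' i % 2 = 0 then X (ρ' i / 2) (γ' j) else Y (ρ' i / 2) (γ' j))) =
        Matrix.of fun i j => R' (ρ' i) (γ' j) + e (ρ' i) * R' (ρ' i - 1) (γ' j) := by
      ext i j
      simp only [R', e, Matrix.of_apply]
      rcases Nat.even_or_odd' (ρ' i) with ⟨k, hk | hk⟩ <;> rw [hk]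
      · have h1 : (2 * k) % 2 = 0 := by omega
        rw [if_pos h1, if_pos h1, if_pos h1, show (2 * k) / 2 = k by omega]
        rcases k with _ | k
        · rw [he0, zero_mul, add_zero]; exact h0 _
        · rw [if_neg (by omega), show (2 * (k + 1) - 1) / 2 = k by omega]; exact hE k _
      · rw [if_neg (by omega), if_neg (by omega), if_neg (by omega), if_pos (by omega),
          show (2 * k + 1) / 2 = k by omega, show (2 * k + 1 - 1) / 2 = k by omega]
        exact hO k _
    rw [heq]
    refine HurwitzPair.step_tn R' e (fun t => ?_) ?_ (fun n' ρ'' γ'' h1 h2 => hTN n' ρ'' γ'' h1 h2) ρ' γ' hρ' hγ'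
    · show 0 ≤ (if t % 2 = 0 then eE (t / 2) else eO (t / 2)); split_ifs; exacts [heE _, heO _]
    · show (if 0 % 2 = 0 then eE (0 / 2) else eO (0 / 2)) = 0; rw [if_pos rfl]; exact he0
  have hK1 : 0 < (b * β₂ + b * β₃ + (r + 2) * β₂ * β₃) := by positivity
  have hK1ne : (b * β₂ + b * β₃ + (r + 2) * β₂ * β₃) ≠ 0 := hK1.ne'
  have hδ2 : 0 < (β₂ - β₃) ^ 2 := by have h : β₂ - β₃ ≠ 0 := sub_ne_zero.2 hne; positivity
  let F21f : ℕ → ℝ := fun k => b ^ 2 * β₂ + b ^ 2 * β₃ + (2 * (k : ℝ) + r + 1) * b * β₂ ^ 2 - 2 * ((k : ℝ) + 3 * r - 2) * b * β₂ * β₃ + (2 * (k : ℝ) + r + 1) * b * β₃ ^ 2 + (r + 2) * (2 * (k : ℝ) + r + 1) * β₂ ^ 2 * β₃ + (r + 2) * (2 * (k : ℝ) + r + 1) * β₂ * β₃ ^ 2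
  let D2f : ℕ → ℝ := fun k => 2 * b ^ 2 * β₂ ^ 2 - 2 * b ^ 2 * β₂ * β₃ + 2 * b ^ 2 * β₃ ^ 2 - 2 * (r - 1) * b * β₂ ^ 2 * β₃ - 2 * (r - 1) * b * β₂ * β₃ ^ 2 + (r + 2) * (3 * (k : ℝ) + 2 * r + 1) * β₂ ^ 2 * β₃ ^ 2
  let P20f : ℕ → ℝ := fun k => ((k : ℝ) + 2 * r) * b ^ 2 * β₂ ^ 2 - 2 * ((k : ℝ) + r) * b ^ 2 * β₂ * β₃ + ((k : ℝ) + 2 * r) * b ^ 2 * β₃ ^ 2 - 2 * r * ((k : ℝ) + r - 1) * b * β₂ ^ 2 * β₃ - 2 * r * ((k : ℝ) + r - 1) * b * β₂ * β₃ ^ 2 + 2 * ((k : ℝ) + r) * (r + 2) * ((k : ℝ) + r - 1) * β₂ ^ 2 * β₃ ^ 2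
  let P36f : ℕ → ℝ := fun k => b ^ 3 * β₂ ^ 2 - 2 * b ^ 3 * β₂ * β₃ + b ^ 3 * β₃ ^ 2 + (r + 1) * b ^ 2 * β₂ ^ 3 - b ^ 2 * β₂ ^ 2 * β₃ - b ^ 2 * β₂ * β₃ ^ 2 + (r + 1) * b ^ 2 * β₃ ^ 3 - 2 * (r + 1) * ((k : ℝ) + r - 1) * b * β₂ ^ 3 * β₃ + 4 * ((k : ℝ) + r - 1) * b * β₂ ^ 2 * β₃ ^ 2 - 2 * (r + 1) * ((k : ℝ) + r - 1) * b * β₂ * β₃ ^ 3 + ((k : ℝ) + r) * (r + 2) * ((k : ℝ) + r - 1) * β₂ ^ 3 * β₃ ^ 2 + ((k : ℝ) + r) * (r + 2) * ((k : ℝ) + r - 1) * β₂ ^ 2 * β₃ ^ 3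
  let P105f : ℕ → ℝ := fun k => b ^ 4 * β₂ ^ 2 - 2 * b ^ 4 * β₂ * β₃ + b ^ 4 * β₃ ^ 2 - 2 * (r - 1) * b ^ 3 * β₂ ^ 3 + 2 * (r - 1) * b ^ 3 * β₂ ^ 2 * β₃ + 2 * (r - 1) * b ^ 3 * β₂ * β₃ ^ 2 - 2 * (r - 1) * b ^ 3 * β₃ ^ 3 + (r + 1) * (2 * (k : ℝ) + r + 1) * b ^ 2 * β₂ ^ 4 + 2 * ((k : ℝ) * r - 3 * (k : ℝ) + r ^ 2 - 4 * r + 1) * b ^ 2 * β₂ ^ 3 * β₃ - 2 * (3 * (k : ℝ) * r - 4 * (k : ℝ) + 3 * r ^ 2 - 7 * r + 3) * b ^ 2 * β₂ ^ 2 * β₃ ^ 2 + 2 * ((k : ℝ) * r - 3 * (k : ℝ) + r ^ 2 - 4 * r + 1) * b ^ 2 * β₂ * β₃ ^ 3 + (r + 1) * (2 * (k : ℝ) + r + 1) * b ^ 2 * β₃ ^ 4 - 2 * (r + 1) * ((k : ℝ) + r - 1) * (2 * (k : ℝ) + r + 1) * b * β₂ ^ 4 * β₃ + 2 * ((k : ℝ)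 + r - 1) * ((k : ℝ) * r + 2 * (k : ℝ) + r ^ 2 + r + 1) * b * β₂ ^ 3 * β₃ ^ 2 + 2 * ((k : ℝ) + r - 1) * ((k : ℝ) * r + 2 * (k : ℝ) + r ^ 2 + r + 1) * b * β₂ ^ 2 * β₃ ^ 3 - 2 * (r + 1) * ((k : ℝ) + r - 1) * (2 * (k : ℝ) + r + 1) * b * β₂ * β₃ ^ 4 + ((k : ℝ) + r) * (r + 2) * ((k : ℝ) + r - 1) * (2 * (k : ℝ) + r + 1) * β₂ ^ 4 * β₃ ^ 2 - 2 * ((k : ℝ) + r) ^ 2 * (r + 2) * ((k : ℝ) + r - 1) * β₂ ^ 3 * β₃ ^ 3 + ((k : ℝ) + r) * (r + 2) * ((k : ℝ) + r - 1) * (2 * (k : ℝ) + r + 1) * β₂ ^ 2 * β₃ ^ 4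
  let P69f : ℕ → ℝ := fun k => r * b ^ 4 - 2 * r * ((k : ℝ) + r - 1) * b ^ 3 * β₂ - 2 * r * ((k : ℝ) + r - 1) * b ^ 3 * β₃ + ((k : ℝ) + r) * (r + 1) * ((k : ℝ) + r - 1) * b ^ 2 * β₂ ^ 2 + 2 * r * ((k : ℝ) + r - 1) * (2 * (k : ℝ) + 2 * r - 3) * b ^ 2 * β₂ * β₃ + ((k : ℝ) + r) * (r + 1) * ((k : ℝ) + r - 1) * b ^ 2 * β₃ ^ 2 - 2 * ((k : ℝ) + r) * (r + 1) * ((k : ℝ) + r - 2) * ((k : ℝ) + r - 1) * b * β₂ ^ 2 * β₃ - 2 * ((k : ℝ) + r) * (r + 1) * ((k : ℝ) + r - 2) * ((k : ℝ) + r - 1) * b * β₂ * β₃ ^ 2 + ((k : ℝ) + r) * (r + 2) * ((k : ℝ) + r - 2) * ((k : ℝ) + r - 1) ^ 2 * β₂ ^ 2 * β₃ ^ 2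
  let Gc : ℝ := b ^ 2 * β₂ + b ^ 2 * β₃ + (r + 1) * b * β₂ ^ 2 - 2 * (3 * r + 1) * b * β₂ * β₃ + (r + 1) * b * β₃ ^ 2 + (r + 1) * (r + 2) * β₂ ^ 2 * β₃ + (r + 1) * (r + 2) * β₂ * β₃ ^ 2
  have hF21f : ∀ k : ℕ, F21f k = b ^ 2 * β₂ + b ^ 2 * β₃ + (2 * (k : ℝ) + r + 1) * b * β₂ ^ 2 - 2 * ((k : ℝ) + 3 * r - 2) * b * β₂ * β₃ + (2 * (k : ℝ) + r + 1) * b * β₃ ^ 2 + (r + 2) * (2 * (k : ℝ) + r + 1) * β₂ ^ 2 * β₃ + (r + 2) * (2 * (k : ℝ) + r + 1) * β₂ * β₃ ^ 2 := fun k => rfl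
  have hD2f : ∀ k : ℕ, D2f k = 2 * b ^ 2 * β₂ ^ 2 - 2 * b ^ 2 * β₂ * β₃ + 2 * b ^ 2 * β₃ ^ 2 - 2 * (r - 1) * b * β₂ ^ 2 * β₃ - 2 * (r - 1) * b * β₂ * β₃ ^ 2 + (r + 2) * (3 * (k : ℝ) + 2 * r + 1) * β₂ ^ 2 * β₃ ^ 2 := fun k => rfl
  have hP20f : ∀ k : ℕ, P20f k = ((k : ℝ) + 2 * r) * b ^ 2 * β₂ ^ 2 - 2 * ((k : ℝ) + r) * b ^ 2 * β₂ * β₃ + ((k : ℝ) + 2 * r) * b ^ 2 * β₃ ^ 2 - 2 * r * ((k : ℝ) + r - 1) * b * β₂ ^ 2 * β₃ - 2 * r * ((k : ℝ) + r - 1) * b * β₂ * β₃ ^ 2 + 2 * ((k : ℝ) + r) * (r + 2) * ((k : ℝ) + r - 1) * β₂ ^ 2 * β₃ ^ 2 := fun k => rfl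
  have hP36f : ∀ k : ℕ, P36f k = b ^ 3 * β₂ ^ 2 - 2 * b ^ 3 * β₂ * β₃ + b ^ 3 * β₃ ^ 2 + (r + 1) * b ^ 2 * β₂ ^ 3 - b ^ 2 * β₂ ^ 2 * β₃ - b ^ 2 * β₂ * β₃ ^ 2 + (r + 1) * b ^ 2 * β₃ ^ 3 - 2 * (r + 1) * ((k : ℝ) + r - 1) * b * β₂ ^ 3 * β₃ + 4 * ((k : ℝ) + r - 1) * b * β₂ ^ 2 * β₃ ^ 2 - 2 * (r + 1) * ((k : ℝ) + r - 1) * b * β₂ * β₃ ^ 3 + ((k : ℝ) + r) * (r + 2) * ((k : ℝ) + r - 1) * β₂ ^ 3 * β₃ ^ 2 + ((k : ℝ) + r) * (r + 2) * ((k : ℝ) + r - 1) * β₂ ^ 2 * β₃ ^ 3 := fun k => rfl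
  have hP105f : ∀ k : ℕ, P105f k = b ^ 4 * β₂ ^ 2 - 2 * b ^ 4 * β₂ * β₃ + b ^ 4 * β₃ ^ 2 - 2 * (r - 1) * b ^ 3 * β₂ ^ 3 + 2 * (r - 1) * b ^ 3 * β₂ ^ 2 * β₃ + 2 * (r - 1) * b ^ 3 * β₂ * β₃ ^ 2 - 2 * (r - 1) * b ^ 3 * β₃ ^ 3 + (r + 1) * (2 * (k : ℝ) + r + 1) * b ^ 2 * β₂ ^ 4 + 2 * ((k : ℝ) * r - 3 * (k : ℝ) + r ^ 2 - 4 * r + 1) * b ^ 2 * β₂ ^ 3 * β₃ - 2 * (3 * (k : ℝ) * r - 4 * (k : ℝ) + 3 * r ^ 2 - 7 * r + 3) * b ^ 2 * β₂ ^ 2 * β₃ ^ 2 + 2 * ((k : ℝ) * r - 3 * (k : ℝ) + r ^ 2 - 4 * r + 1) * b ^ 2 * β₂ * β₃ ^ 3 + (r + 1) * (2 * (k : ℝ) + r + 1) * b ^ 2 * β₃ ^ 4 - 2 * (r + 1) * ((k : ℝ) + r - 1) * (2 * (k : ℝ) + r + 1) * b * β₂ ^ 4 * β₃ + 2 * ((k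 : ℝ) + r - 1) * ((k : ℝ) * r + 2 * (k : ℝ) + r ^ 2 + r + 1) * b * β₂ ^ 3 * β₃ ^ 2 + 2 * ((k : ℝ) + r - 1) * ((k : ℝ) * r + 2 * (k : ℝ) + r ^ 2 + r + 1) * b * β₂ ^ 2 * β₃ ^ 3 - 2 * (r + 1) * ((k : ℝ) + r - 1) * (2 * (k : ℝ) + r + 1) * b * β₂ * β₃ ^ 4 + ((k : ℝ) + r) * (r + 2) * ((k : ℝ) + r - 1) * (2 * (k : ℝ) + r + 1) * β₂ ^ 4 * β₃ ^ 2 - 2 * ((k : ℝ) + r) ^ 2 * (r + 2) * ((k : ℝ) + r - 1) * β₂ ^ 3 * β₃ ^ 3 + ((k : ℝ) + r) * (r + 2) * ((k : ℝ) + r - 1) * (2 * (k : ℝ) + r + 1) * β₂ ^ 2 * β₃ ^ 4 := fun k => rfl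
  have hP69f : ∀ k : ℕ, P69f k = r * b ^ 4 - 2 * r * ((k : ℝ) + r - 1) * b ^ 3 * β₂ - 2 * r * ((k : ℝ) + r - 1) * b ^ 3 * β₃ + ((k : ℝ) + r) * (r + 1) * ((k : ℝ) + r - 1) * b ^ 2 * β₂ ^ 2 + 2 * r * ((k : ℝ) + r - 1) * (2 * (k : ℝ) + 2 * r - 3) * b ^ 2 * β₂ * β₃ + ((k : ℝ) + r) * (r + 1) * ((k : ℝ) + r - 1) * b ^ 2 * β₃ ^ 2 - 2 * ((k : ℝ) + r) * (r + 1) * ((k : ℝ) + r - 2) * ((k : ℝ) + r - 1) * b * β₂ ^ 2 * β₃ - 2 * ((k : ℝ) + r) * (r + 1) * ((k : ℝ) + r - 2) * ((k : ℝ) + r - 1) * b * β₂ * β₃ ^ 2 + ((k : ℝ) + r) * (r + 2) * ((k : ℝ) + r - 2) * ((k : ℝ) + r - 1) ^ 2 * β₂ ^ 2 * β₃ ^ 2 := fun k => rfl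
  have hGc : Gc = b ^ 2 * β₂ + b ^ 2 * β₃ + (r + 1) * b * β₂ ^ 2 - 2 * (3 * r + 1) * b * β₂ * β₃ + (r + 1) * b * β₃ ^ 2 + (r + 1) * (r + 2) * β₂ ^ 2 * β₃ + (r + 1) * (r + 2) * β₂ * β₃ ^ 2 := rfl
  have hD2 : ∀ k : ℕ, 0 < D2f k := fun k => d2_pos b β₂ β₃ r k h₂ h₃ hr (Nat.cast_nonneg k)
  have hP36 : ∀ k : ℕ, 1 ≤ k → 0 < P36f k := fun k hk => p36_pos b β₂ β₃ r k hb.le h₂ h₃ hr (by exact_mod_cast hk)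
  have hP105 : ∀ k : ℕ, 1 ≤ k → 0 < P105f k := fun k hk => p105_pos b β₂ β₃ r k h₂ h₃ hr (by exact_mod_cast hk)
  have hP69 : ∀ k : ℕ, 2 ≤ k → 0 < P69f k := fun k hk => p69_pos b β₂ β₃ r k hb h₂ hr (by exact_mod_cast hk)
  have hX := boundaryX_pos b β₂ β₃ r h₂ h₃ hr
  have hF210 : 0 < F21f 0 := by
    have e : F21f 0 = (b ^ 2 * β₂ + b ^ 2 * β₃ - 4 * r * b * β₂ * β₃ + (r + 1) * (r + 2) * β₂ ^ 2 * β₃ + (r + 1) * (r + 2) * β₂ * β₃ ^ 2) + ((β₂ - β₃) ^ 2 * (r + 1) + 6 * β₂ * β₃) * b := by rw [hF21f]; push_cast; ring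
    rw [e]; exact add_pos_of_pos_of_nonneg hX (by positivity)
  have hG : 0 < Gc := by
    have e : Gc = (b ^ 2 * β₂ + b ^ 2 * β₃ - 4 * r * b * β₂ * β₃ + (r + 1) * (r + 2) * β₂ ^ 2 * β₃ + (r + 1) * (r + 2) * β₂ * β₃ ^ 2) + (β₂ - β₃) ^ 2 * (r + 1) * b := by rw [hGc]; ring
    rw [e]; exact add_pos_of_pos_of_nonneg hX (by positivity)
  let a10 : ℕ → ℝ := fun k => (2 * (k : ℝ) + 3 * r) / 3
  let a11 : ℕ → ℝ := fun k =>
    (k : ℝ) * (2 * b + ((k : ℝ) + 2 * r + 1) * β₂ + ((k : ℝ) + 2 * r + 1) * β₃) / 3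
  let a12 : ℕ → ℝ := fun k => (k : ℝ) * ((k : ℝ) - 1) * (b * β₂ + b * β₃ + (r + 2) * β₂ * β₃) / 3
  let μ2 : ℝ := 9 * b * β₂ * β₃ / (b * β₂ + b * β₃ + (r + 2) * β₂ * β₃)
  let b10 : ℕ → ℝ := fun k => F21f k / (b * β₂ + b * β₃ + (r + 2) * β₂ * β₃)
  let b11 : ℕ → ℝ := fun k => (k : ℝ) * D2f k / (b * β₂ + b * β₃ + (r + 2) * β₂ * β₃)
  let μ3 : ℕ → ℝ := fun k => if k = 0 then 0 else (k : ℝ) * (b * β₂ + b * β₃ + (r + 2) * β₂ * β₃) ^ 2 / (3 * D2f (k - 1))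
  let a20 : ℕ → ℝ := fun k => if k = 0 then r else P20f k / D2f (k - 1)
  let a21 : ℕ → ℝ := fun k => if k = 0 then 0 else (k : ℝ) * P36f k / D2f (k - 1)
  let μ4 : ℕ → ℝ := fun k => if k = 0 then 0 else D2f (k - 1) * D2f k / ((b * β₂ + b * β₃ + (r + 2) * β₂ * β₃) * P36f k)
  let b20 : ℕ → ℝ := fun k => if k = 0 then F21f 0 / (b * β₂ + b * β₃ + (r + 2) * β₂ * β₃) else b10 k - μ4 k * a20 k
  let μ5 : ℕ → ℝ := fun k => if k = 0 then 0 else a21 k / b20 (k - 1)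
  let a30 : ℕ → ℝ := fun k => if k = 0 then r else a20 k - μ5 k
  let μ6 : ℕ → ℝ := fun k => b20 k / a30 k
  let μ7 : ℕ → ℝ := fun k => if k = 0 then 0 else a30 k
  have hμ3S : ∀ k : ℕ, μ3 (k + 1) = ((k + 1 : ℕ) : ℝ) * (b * β₂ + b * β₃ + (r + 2) * β₂ * β₃) ^ 2 / (3 * D2f k) := fun k => by
    show (if k + 1 = 0 then (0:ℝ) else _) = _; rw [if_neg (Nat.succ_ne_zero k), Nat.add_sub_cancel]
  have ha20S : ∀ k : ℕ, a20 (k + 1) = P20f (k + 1) / D2f k := fun k => by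
    show (if k + 1 = 0 then r else _) = _; rw [if_neg (Nat.succ_ne_zero k), Nat.add_sub_cancel]
  have ha21S : ∀ k : ℕ, a21 (k + 1) = ((k + 1 : ℕ) : ℝ) * P36f (k + 1) / D2f k := fun k => by
    show (if k + 1 = 0 then (0:ℝ) else _) = _; rw [if_neg (Nat.succ_ne_zero k), Nat.add_sub_cancel]
  have hμ4S : ∀ k : ℕ, μ4 (k + 1) = D2f k * D2f (k + 1) / ((b * β₂ + b * β₃ + (r + 2) * β₂ * β₃) * P36f (k + 1)) := fun k => by
    show (if k + 1 = 0 then (0:ℝ) else _) = _; rw [if_neg (Nat.succ_ne_zero k), Nat.add_sub_cancel]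
  have hb20Z : b20 0 = F21f 0 / (b * β₂ + b * β₃ + (r + 2) * β₂ * β₃) := if_pos rfl
  have hb20S : ∀ k : ℕ, b20 (k + 1) = b10 (k + 1) - μ4 (k + 1) * a20 (k + 1) := fun k => if_neg (Nat.succ_ne_zero k)
  have hμ5S : ∀ k : ℕ, μ5 (k + 1) = a21 (k + 1) / b20 k := fun k => by
    show (if k + 1 = 0 then (0:ℝ) else _) = _; rw [if_neg (Nat.succ_ne_zero k), Nat.add_sub_cancel]
  have ha30Z : a30 0 = r := if_pos rfl
  have ha30S : ∀ k : ℕ, a30 (k + 1) = a20 (k + 1) - μ5 (k + 1) := fun k => if_neg (Nat.succ_ne_zero k)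
  have hμ7S : ∀ k : ℕ, μ7 (k + 1) = a30 (k + 1) := fun k => if_neg (Nat.succ_ne_zero k)
  have hb20form : ∀ k : ℕ, b20 (k + 1) = (b * β₂ + b * β₃ + (r + 2) * β₂ * β₃) * P105f (k + 1) / ((b * β₂ + b * β₃ + (r + 2) * β₂ * β₃) * P36f (k + 1)) := by
    intro k; have hD := (hD2 k).ne'; have hP := (hP36 (k + 1) (by omega)).ne'
    rw [hb20S, eq_div_iff (mul_ne_zero hK1ne hP)]
    have e1 : (b10 (k + 1) - μ4 (k + 1) * a20 (k + 1)) * ((b * β₂ + b * β₃ + (r + 2) * β₂ * β₃) * P36f (k + 1))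
        = F21f (k + 1) * P36f (k + 1) - D2f (k + 1) * P20f (k + 1) := by
      simp only [b10]; rw [hμ4S, ha20S]; field_simp
    rw [e1, hF21f, hP36f, hD2f, hP20f, hP105f]
    exact stage4_id b β₂ β₃ r ((k + 1 : ℕ) : ℝ)
  have hb20pos : ∀ k : ℕ, 0 < b20 k := fun k => by
    rcases k with _ | k
    · rw [hb20Z]; exact div_pos hF210 hK1
    · rw [hb20form k]; exact div_pos (mul_pos hK1 (hP105 _ (by omega))) (mul_pos hK1 (hP36 _ (by omega)))
  have ha30one : a30 1 = r * Gc * D2f 0 / (D2f 0 * F21f 0) := by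
    have hD := (hD2 0).ne'; have hF := hF210.ne'
    have u1 : a30 1 = a20 1 - μ5 1 := if_neg one_ne_zero
    have u2 : μ5 1 = a21 1 / b20 0 := if_neg one_ne_zero
    have u3 : a20 1 = P20f 1 / D2f 0 := if_neg one_ne_zero
    have u4 : a21 1 = ((1 : ℕ) : ℝ) * P36f 1 / D2f 0 := if_neg one_ne_zero
    rw [u1, u2, u3, u4, hb20Z, eq_div_iff (mul_ne_zero hD hF)]
    have e1 : (P20f 1 / D2f 0 - ((1 : ℕ) : ℝ) * P36f 1 / D2f 0 / (F21f 0 / (b * β₂ + b * β₃ + (r + 2) * β₂ * β₃))) * (D2f 0 * F21f 0)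
        = P20f 1 * F21f 0 - (b * β₂ + b * β₃ + (r + 2) * β₂ * β₃) * P36f 1 := by
      push_cast; field_simp
    rw [e1, hP20f, hF21f, hP36f, hD2f, hGc]
    push_cast
    ring
  have ha30two : ∀ k : ℕ, a30 (k + 2) = (b * β₂ + b * β₃ + (r + 2) * β₂ * β₃) * ((β₂ - β₃) ^ 2 * D2f (k + 1) * P69f (k + 2))
      / (D2f (k + 1) * ((b * β₂ + b * β₃ + (r + 2) * β₂ * β₃) * P105f (k + 1))) := by
    intro k; have hD := (hD2 (k + 1)).ne'; have hP := (hP105 (k + 1) (by omega)).ne'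
    have hP' := (hP36 (k + 1) (by omega)).ne'; have h21 : k + 2 - 1 = k + 1 := by omega
    have u1 : a30 (k + 2) = a20 (k + 2) - μ5 (k + 2) := if_neg (by omega)
    have u2 : μ5 (k + 2) = a21 (k + 2) / b20 (k + 1) := by
      show (if k + 2 = 0 then (0:ℝ) else a21 (k + 2) / b20 (k + 2 - 1)) = _; rw [if_neg (by omega), h21]
    have u3 : a20 (k + 2) = P20f (k + 2) / D2f (k + 1) := by
      show (if k + 2 = 0 then r else P20f (k + 2) / D2f (k + 2 - 1)) = _; rw [if_neg (by omega), h21]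
    have u4 : a21 (k + 2) = ((k + 2 : ℕ) : ℝ) * P36f (k + 2) / D2f (k + 1) := by
      show (if k + 2 = 0 then (0:ℝ) else ((k + 2 : ℕ) : ℝ) * P36f (k + 2) / D2f (k + 2 - 1)) = _; rw [if_neg (by omega), h21]
    rw [u1, u2, u3, u4, hb20form k, eq_div_iff (mul_ne_zero hD (mul_ne_zero hK1ne hP))]
    have e1 : (P20f (k + 2) / D2f (k + 1) - ((k + 2 : ℕ) : ℝ) * P36f (k + 2) / D2f (k + 1)
          / ((b * β₂ + b * β₃ + (r + 2) * β₂ * β₃) * P105f (k + 1) / ((b * β₂ + b * β₃ + (r + 2) * β₂ * β₃) * P36f (k + 1)))) * (D2f (k + 1) * ((b * β₂ + b * β₃ + (r + 2) * β₂ * β₃) * P105f (k + 1)))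
        = (b * β₂ + b * β₃ + (r + 2) * β₂ * β₃) * (P20f (k + 2) * P105f (k + 1)
          - ((k + 2 : ℕ) : ℝ) * P36f (k + 1) * P36f (k + 2)) := by
      field_simp
    rw [e1]
    congr 1
    have hc : ((k + 2 : ℕ) : ℝ) = ((k + 1 : ℕ) : ℝ) + 1 := by push_cast; ring
    rw [hP20f, hP105f, hP36f, hP36f, hD2f, hP69f, hc]
    exact stage5_id b β₂ β₃ r ((k + 1 : ℕ) : ℝ)
  have ha30pos : ∀ k : ℕ, 0 < a30 k := fun k => by
    rcases k with _ | _ | k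
    · rw [ha30Z]; exact hr
    · show 0 < a30 1; rw [ha30one]; exact div_pos (mul_pos (mul_pos hr hG) (hD2 0)) (mul_pos (hD2 0) hF210)
    · show 0 < a30 (k + 2); rw [ha30two k]
      exact div_pos (mul_pos hK1 (mul_pos (mul_pos hδ2 (hD2 _)) (hP69 _ (by omega))))
        (mul_pos (hD2 _) (mul_pos hK1 (hP105 _ (by omega))))
  have ha21nn : ∀ k : ℕ, 0 ≤ a21 k := fun k => by
    rcases k with _ | k
    · exact le_of_eq (if_pos rfl).symm
    · rw [ha21S]; exact div_nonneg (mul_nonneg (Nat.cast_nonneg _) (hP36 _ (by omega)).le) (hD2 k).le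
  have hμ3nn : ∀ k : ℕ, 0 ≤ μ3 k := fun k => by
    rcases k with _ | k
    · exact le_of_eq (if_pos rfl).symm
    · rw [hμ3S]; exact div_nonneg (by positivity) (mul_nonneg (by norm_num) (hD2 k).le)
  have hμ4nn : ∀ k : ℕ, 0 ≤ μ4 k := fun k => by
    rcases k with _ | k
    · exact le_of_eq (if_pos rfl).symm
    · rw [hμ4S]; exact div_nonneg (mul_nonneg (hD2 _).le (hD2 _).le) (mul_nonneg hK1.le (hP36 _ (by omega)).le)
  have hμ5nn : ∀ k : ℕ, 0 ≤ μ5 k := fun k => by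
    rcases k with _ | k
    · exact le_of_eq (if_pos rfl).symm
    · rw [hμ5S]; exact div_nonneg (ha21nn _) (hb20pos _).le
  have hμ6nn : ∀ k : ℕ, 0 ≤ μ6 k := fun k => div_nonneg (hb20pos k).le (ha30pos k).le
  have hμ7nn : ∀ k : ℕ, 0 ≤ μ7 k := fun k => by
    rcases k with _ | k
    · exact le_of_eq (if_pos rfl).symm
    · rw [hμ7S]; exact (ha30pos _).le
  let rowW : ℕ → ℕ → ℝ := fun k l =>
    if l = k then κ₀ k else if l + 1 = k then κ₁ k else if l + 2 = k then κ₂ k else if l + 3 = k then κ₃ k else 0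
  let rowC : ℕ → ℕ → ℝ := fun k l => if l = k + 1 then κ₀ (k + 1) - κ₀ k else if l = k then κ₁ (k + 1) - κ₁ k
      else if l + 1 = k then κ₂ (k + 1) - κ₂ k else if l + 2 = k then κ₃ (k + 1) - κ₃ k else 0
  let A1 : ℕ → ℕ → ℝ := fun k l => if l = k then a10 k else if l + 1 = k then a11 k else if l + 2 = k then a12 k else 0
  let B1 : ℕ → ℕ → ℝ := fun k l => if l = k + 1 then 1 else if l = k then b10 k else if l + 1 = k then b11 k else 0
  let A2 : ℕ → ℕ → ℝ := fun k l => if l = k then a20 k else if l + 1 = k then a21 k else 0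
  let B2 : ℕ → ℕ → ℝ := fun k l => if l = k + 1 then 1 else if l = k then b20 k else 0
  let A3 : ℕ → ℕ → ℝ := fun k l => if l = k then a30 k else 0
  let B3 : ℕ → ℕ → ℝ := fun k l => if l = k + 1 then (1:ℝ) else 0
  let A4 : ℕ → ℕ → ℝ := fun k l => if k = 0 ∧ l = 0 then r else 0
  have I1Z : ∀ l, rowW 0 l = A1 0 l := by
    intro l; simp only [rowW, A1, a10, a11, a12, hκ₀, hκ₁, hκ₂, hκ₃]
    split_ifs <;> first | (exfalso; omega) | ring1
  have I1S : ∀ k l, rowW (k + 1) l = A1 (k + 1) l + ((k + 1 : ℕ) : ℝ) / 3 * rowC k l := by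
    intro k l; simp only [rowW, rowC, A1, a10, a11, a12, hκ₀, hκ₁, hκ₂, hκ₃]
    split_ifs <;> first | (exfalso; omega) | ring1 | (push_cast; ring1)
  have I2 : ∀ k l, rowC k l = B1 k l + μ2 * A1 k l := by
    intro k l; simp only [rowC, B1, A1, a10, a11, a12, b10, b11, μ2, hκ₀, hκ₁, hκ₂, hκ₃, hF21f, hD2f]
    split_ifs <;> first | (exfalso; omega) | ring1 | (push_cast; ring1) | (push_cast; field_simp; ring1)
  have I3Z : ∀ l, A1 0 l = A2 0 l := by
    intro l; simp only [A1, A2, a10, a11, show a20 0 = r from if_pos rfl, show a21 0 = (0:ℝ) from if_pos rfl]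
    split_ifs <;> first | (exfalso; omega) | ring1
  have I3S : ∀ k l, A1 (k + 1) l = A2 (k + 1) l + μ3 (k + 1) * B1 k l := by
    intro k l; have hD := (hD2 k).ne'; rw [hμ3S]; simp only [A1, A2, B1, a10, a11, a12, b10, b11]
    split_ifs <;>
      first
        | (exfalso; omega)
        | (rw [ha20S]; field_simp; rw [hD2f, hP20f]; push_cast; ring1)
        | (rw [ha21S]; field_simp; rw [hD2f, hP36f, hF21f]; push_cast; ring1)
        | ring1
        | (field_simp; push_cast; ring1)
  have I4 : ∀ k l, B1 k l = B2 k l + μ4 k * A2 k l := by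
    intro k l
    rcases k with _ | k
    · simp only [B1, B2, A2, hb20Z, b10, show μ4 0 = 0 from if_pos rfl]
      split_ifs <;> first | (exfalso; omega) | ring1
    · have hD := (hD2 k).ne'; have hP := (hP36 (k + 1) (by omega)).ne'
      simp only [B1, B2, A2, hb20S, hμ4S, ha21S, b11]
      split_ifs <;> first | (exfalso; omega) | ring1 | (push_cast; field_simp; ring1)
  have I5Z : ∀ l, A2 0 l = A3 0 l := by
    intro l; simp only [A2, A3, ha30Z, show a20 0 = r from if_pos rfl, show a21 0 = (0:ℝ) from if_pos rfl]
    split_ifs <;> first | (exfalso; omega) | rfl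
  have I5S : ∀ k l, A2 (k + 1) l = A3 (k + 1) l + μ5 (k + 1) * B2 k l := by
    intro k l; have hbk := (hb20pos k).ne'; simp only [A2, A3, B2, ha30S, hμ5S]
    split_ifs <;> first | (exfalso; omega) | ring1 | (rw [zero_add, div_mul_cancel₀ _ hbk])
  have I6 : ∀ k l, B2 k l = B3 k l + μ6 k * A3 k l := by
    intro k l; have hak := (ha30pos k).ne'; simp only [B2, B3, A3, μ6]
    split_ifs <;> first | (exfalso; omega) | ring1 | (rw [zero_add, div_mul_cancel₀ _ hak])
  have I7Z : ∀ l, A3 0 l = A4 0 l := by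
    intro l; simp only [A3, A4, ha30Z, true_and]
  have I7S : ∀ k l, A3 (k + 1) l = A4 (k + 1) l + μ7 (k + 1) * B3 k l := by
    intro k l; simp only [A3, A4, B3, hμ7S, if_neg (show ¬ (k + 1 = 0 ∧ l = 0) by omega)]
    split_ifs <;> ring1
  have T7 : ∀ (n : ℕ) (ρ' γ' : Fin n → ℕ), StrictMono ρ' → StrictMono γ' →
      0 ≤ (Matrix.of fun i j =>
        (if ρ' i % 2 = 0 then A4 (ρ' i / 2) (γ' j) else B3 (ρ' i / 2) (γ' j))).det := by
    intro n ρ' γ' hρ' hγ'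
    refine StairTN.stairs_minor_nonneg (fun t l => if t % 2 = 0 then A4 (t / 2) l else B3 (t / 2) l)
      (fun t => (t + 1) / 2) (fun t => (t + 1) / 2) (fun _ => le_rfl) (fun t => by omega)
      ?_ ?_ ?_ ρ' γ' hρ' hγ'
    · intro t l
      show 0 ≤ (if t % 2 = 0 then A4 (t / 2) l else B3 (t / 2) l)
      by_cases h : t % 2 = 0
      · rw [if_pos h]; show 0 ≤ (if t / 2 = 0 ∧ l = 0 then r else 0); split_ifs; exacts [hr.le, le_rfl]
      · rw [if_neg h]; show 0 ≤ (if l = t / 2 + 1 then (1:ℝ) else 0); split_ifs; exacts [zero_le_one, le_rfl]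
    all_goals intro t l hl; show (if t % 2 = 0 then A4 (t / 2) l else B3 (t / 2) l) = 0; by_cases h : t % 2 = 0
    · rw [if_pos h]; exact if_neg (by omega)
    · rw [if_neg h]; exact if_neg (by omega)
    · rw [if_pos h]; exact if_neg (by omega)
    · rw [if_neg h]; exact if_neg (by omega)
  have T6 := stage A3 B3 A4 B3 μ7 (fun _ => 0) I7Z I7S (fun k l => by ring) (if_pos rfl) hμ7nn (fun _ => le_rfl) T7
  have T5 := stage A3 B2 A3 B3 (fun _ => 0) μ6 (fun l => rfl) (fun k l => by ring) I6 rfl (fun _ => le_rfl) hμ6nn T6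
  have T4 := stage A2 B2 A3 B2 μ5 (fun _ => 0) I5Z I5S (fun k l => by ring) (if_pos rfl) hμ5nn (fun _ => le_rfl) T5
  have T3 := stage A2 B1 A2 B2 (fun _ => 0) μ4 (fun l => rfl) (fun k l => by ring) I4 rfl (fun _ => le_rfl) hμ4nn T4
  have T2 := stage A1 B1 A2 B1 μ3 (fun _ => 0) I3Z I3S (fun k l => by ring) (if_pos rfl) hμ3nn (fun _ => le_rfl) T3
  have T1 := stage A1 rowC A1 B1 (fun _ => 0) (fun _ => μ2) (fun l => rfl) (fun k l => by ring) I2 rfl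
    (fun _ => le_rfl) (fun _ => by positivity) T2
  have T0 := stage rowW rowC A1 rowC (fun k => ((k : ℕ) : ℝ) / 3) (fun _ => 0) I1Z I1S (fun k l => by ring) (by simp)
    (fun _ => by positivity) (fun _ => le_rfl) T1
  exact T0 m ρ γ hρ hγ

end NeutralTwoClassical

end Summit.CriticalPhenomena.PercolationContinuityZ3.Theorems
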